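import Literature.MathematicalPhysics.QuantumFieldTheory.Dimock2011to13.HistorySum

/-!
# Dimock, *The renormalization group according to Balaban* III, §3.5 LEMMA 14 (ugh2): the volume of the large-field
regions `Λ_k^c` — the region recursion (understood) TYPED on the tower of tori of `HistorySum.Hist`, the covering
(claim) and the volume bound PROVED with an explicit `𝒪(1)`, and the shape `HistorySum.Ugh2Bound` DISCHARGED

**Citation header (reproduction of PUBLISHED work; template of the Balaban lattice Yang–Mills cell).**
J. Dimock, *The renormalization group according to Balaban. III. Convergence*, Ann. Henri Poincaré **15** (2014)
2133–2175 (= arXiv:1304.0705v1) [Dimock2013BalabanIII]: §3.2 "first bounds" (the histories `{P_j, Q_j, R_j}` and the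
recursion (understood), TeX L1651–1662), §3.5 "convergence" (eq. (ugh1)
TeX L2164–2170, **Lemma 14 = eq. (ugh2) TeX L2173–2177 with its proof TeX L2180–2249**: the covering (claim) L2181–2190,
the induction L2194–2226, the volume count L2229–2238, the arithmetic L2239–2249), and the sentence TeX L2310 of the
proof of Lemma 15.  J. Dimock, *… II. Large fields*, J. Math. Phys. **54** (2013) 092301 (= arXiv:1212.5562v2)
[Dimock2013BalabanII]: §3.1 for the enlargements `X^{∼n}`, `X^* = X^{∼[r_k]}`, `X^{n*}` (§3.1.5 "buffers", TeX
L1849–1880) and `r_k = (−log λ_k)^r` (§3.1.1, TeX L1652–1655), §3.5 "new small field region" for `Λ̄_k` (TeX L2708) and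
the layers of the step `k → k+1` (TeX L2725–2726); §2 of III for the last step (footnote TeX L428–431; §2.4 TeX L795).
Lemma numbers are those of the global counter of the arXiv source (Lemma 14 = (ugh2), Lemma 15 = (sushi); cf. this
lineage's `…HistorySum`).  TeX line numbers refer to the sources held by the cell (`inputs/files/dimock/src/1304.0705/
1304.0705.tex`, `…/1212.5562/1212.5562.tex`); every quotation below was read there this session.  Dimock's papers are
published and refereed and are the cell's TEMPLATE, not manuscripts under audit; no quantity of the Bałaban series
is touched.

**Why this module.**  `…HistorySum` (p184763) made [Dimock2013BalabanIII] §3 kernel over the cell's torus model from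
the analytic outputs (stingray) ∧ (under) ∧ (randall) **and Lemma 14** on, keeping Lemma 14 — a covering statement
about Dimock's own regions `Λ_k^c`, which the model did not carry — as the one quoted geometric leaf (the hypothesis
shape `HistorySum.Ugh2Bound`, with the volumes `|(Λ_j^c)^{(j)}|` of (randall) abstracted as a function `v` of the
history; `HistorySum` reading (i); the lineage's hand-off, gen 16: *"D3 Lemma 14 (ugh2) over the cell's torus model
is the only non-analytic template statement left (needs a typed version of the region recursion (understood) …)"*).
This module supplies exactly that: the recursion (understood) typed on the tower of
tori `TPt d (L^{𝖭−j}·n)`, `j = 0, …, 𝖭+1`, that `HistorySum.Hist` already uses for the regions, Lemma 14 PROVED there for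
the regions of an ARBITRARY history, and the shape discharged for the actual volumes — so that on the template side
everything of §3 after Dimock's cut *"At this point all the fields are gone"* (TeX L2155) is kernel-checked from
(stingray) ∧ (under) ∧ (randall) alone (`stability_of_regions`), with no geometric leaf left.

**What is reproduced here (kernel-checked; Mathlib + the imported cell modules only).**
* Part 1 — sup-norm balls `x^{∼s}` and enlargements `X^{∼s} = ⋃_{□⊂X} □^{∼s}` ([Dimock2013BalabanII] TeX L1849–1851) on
  the torus `(ℤ/N′)^d` as unions of translated boxes (`tball`, `enl`), with `|x^{∼s}| ≤ (2s+1)^d`, radius additivity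
  `(X^{∼s})^{∼s′} ⊆ X^{∼(s+s′)}` and the elementary monotonicities.
* Part 2 — the block map between two tori of a tower (`czmap`; = pv22's `tcoarse` on the modulus `Ls·Nc`, stated for
  a free fine modulus so that it runs along the tower WITHOUT transport), that it is onto, that it takes `x^{∼s}` into
  `(block of x)^{∼(⌊s/Ls⌋+1)}` (`czmap_mem_tball` — the discrete content of *"scaling down by L^{−1}"* plus the
  re-alignment *"adding less than 2LM to the width"*, TeX L2207–2225), that a block lies in the `(Ls−1)`-ball of any of
  its cubes, and `(Λ̄)^c` = the blocks all of whose cubes lie in `Λ^c` (`cinside`; II TeX L2708).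
* Part 3 — unions of balls over levels (`ucover`, the shape of (claim)) and their volume `≤ Σ_i |C_i|(2ρ_i+1)^d`.
* Part 4 — **THE RECURSION (understood) TYPED** for a history `h : HistorySum.Hist d L n N` and a layer schedule `t`
  (`t j = [r_j]`): `Ω^c_j = ((Λ̄_{j−1})^c)^{5*} ∪ P_j^{5*}`, `Λ^c_j = (Ω^c_j)^{5*} ∪ Q_j^{5*} ∪ R_j^{5*}` (`omegaC`,
  `lambdaStep`, `lamC`, `omC`), run from `Λ_{−1} =` the torus, the step `j → j+1` coarsening by `Lstep_j = L` for `j < 𝖭`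
  and by `1` at the last step (TeX L431/L795); **THE COVERING (claim) PROVED** (`lamC_subset_cover`: `Λ^c_k ⊆ ⋃_{i≤k}
  ⋃_{c ∈ 𝒞_i forwarded} c^{∼rad_{i,k}}`, by the printed induction with the centres pushed forward along the block maps
  and the printed radius recursion `rad_{i,i} = 10[r_i]`, `rad_{i,k+1} = ⌊rad_{i,k}/Lstep_k⌋ + 1 + 10[r_{k+1}]`), and
  the volume count `#Λ^c_k ≤ Σ_{i≤k} |𝒞_i| (2 rad_{i,k} + 1)^d` (`card_lamC_le`).
* Part 5 — **THE ARITHMETIC** (TeX L2239–2249) with every constant explicit: `rad_{i,k} ≤ Σ_{e≤k−i}(10[r_{k−e}]+1)L^{−e}`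
  (`rad_le_sum`), *"r_{k−j} ≤ (1 + j log L)^r r_k"* (`Large.lay_sub_le`, needs `−log λ_k ≥ 1`), the series bound
  `Σ_e (1 + e log L)^r L^{−e} ≤ 3·4^r·r!` for `log L ≥ 1` (`series_le`, from `u^r ≤ 2^r r! e^{u/2}` and `e^{−1/2} ≤
  2/3`), whence `rad_{i,k} ≤ G(r)·r_k` for ALL `i ≤ k ≤ 𝖭+1` (`rad_le_Gr`, `G(r) = 30·4^r·r! + 25/2`) and **LEMMA 14 ON
  THE MODEL**: `#Λ^c_k ≤ (2G(r)+1)^d r_k^d Σ_{i≤k} |𝒞_i|` (`card_lamC_le_ell`).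
* Part 6 — at `d = 3`: the volumes `v h j = M³·#Λ^c_j(h)` (`vol`; (ugh1) TeX L2166–2170) and **`HistorySum.Ugh2Bound`
  DISCHARGED** with `𝒪(1) = A14 r = (2G(r)+1)³` for any finite set of histories whose top region has `≥ |Θ|_M` cubes
  (`ugh2Bound_regions`), in particular for `regionHist Θ` = the free histories over `Θ` with `Λ^c_{𝖭+1} = Θ`
  (`ugh2Bound_regionHist`); and the END CHAIN `stability_of_regions` = `HistorySum.stability_of_randall` with the
  (ugh2) hypothesis GONE ((randall) asked on `regionHist Θ` for the actual volumes; `LargeLog` at `A = A14 r`).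
* Part 7 (placed right after Part 4 in the file: it needs no arithmetic) — the TACIT NESTING behind TeX L2310
  *"contained in Θ"*: `P_j, Q_j, R_j ⊆ Λ^c_j` (`slot_subset_lamC`) and `Λ^c_j ⊆ Λ^c_{j+1}` through the block map
  (`image_lamC_subset_succ`) under the explicit conditions (N1) `L − 1 ≤ 5[r_j]`, (N2) `⌊5[r_j]/L⌋ + 1 ≤ 5[r_{j+1}]` at
  the rescaling steps — a Dimock-internal tacit step, made explicit (reading (vi)).
* Part 8 (v1.1) — THE PRINT'S INDEX SET OF (randall) IS INSIDE `regionHist Θ`: the block maps of the tower commute with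
  `HistorySum.fine`'s one-shot block map (`tcoarse_cz`: `tcoarse (L^{𝖭−(j+1)}) n ∘ cz_j = tcoarse (L^{𝖭−j}) n`, so
  membership over `Θ` is invariant along the tower, `mem_fine_iff_iter`), hence a history whose regions are nested
  ((N1)–(N2)) and whose top region lies over `Θ` is free over `Θ` (`mem_freeHist_of_nested` — the content of TeX L2310)
  and belongs to `regionHist Θ` (`mem_regionHist_of_nested`); and (N1)–(N2) themselves follow from smallness of `λ` at
  fixed `L, r`: `L ≤ (−log λ)^r` and `(1 + log L/(−log λ))^r ≤ 2` (`nesting_of_small`).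

**Readings / divergences (declared).**  (i) LEVEL `−1`: the recursion is run uniformly from `j = 0` with
`(Λ̄_{−1})^c = ∅`, giving `Λ^c_0 = P_0^{10*} ∪ Q_0^{5*} ∪ R_0^{5*}`; print (TeX L2195): *"We have Λ_0^c = Q_0^{5*}"* under
its convention *"P₀, R₀, Q_{𝖭+1}, P_{𝖭+1} = ∅"* (TeX L1652) — the four slots are free here exactly as in `HistorySum`
(reading (ii) there); with them empty the typed regions are the printed ones.  (ii) `X^{5*} := X^{∼5[r]}` directly (II
TeX L1867 *"X^{2*} = X^{**}"*; on the cube lattice `(X^{∼a})^{∼b} = X^{∼(a+b)}`, here only `⊆` is used,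
`enl_enl_subset`).  (iii) THE LAST STEP has the parameters of level `𝖭`: `[r_{𝖭+1}] = [r_𝖭]` (`ellN_last`; TeX L428–431:
`Ω_{𝖭+1} ≡ Λ_𝖭^{5♮}` in `𝕋^{−𝖭}_𝖬` with `[r_𝖭]` layers of `M` cubes) and no rescaling (`Lstep_𝖭 = 1`, `Λ̄_𝖭 = Λ_𝖭`) —
`HistorySum` reading (iii).  (iv) CONSTANTS: the print's generous `22[r]` per level (TeX L2184–2222) is replaced by the
exact bookkeeping `10[r] (+1)` in RADIUS form (cubes of side `2·rad+1`); the printed `𝒪(1)` of (ugh2) becomes the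
explicit `A14 r = (2G(r)+1)³`, independent of `L, M, λ, 𝖭, n` and the history, depending on the fixed exponent `r` of
`r_k = (−log λ_k)^r` (II TeX L1655 *"some postive [sic] integer r"*) — as it must: the print's bracket *"[Σ_{j=0}^k
L^{−j}(1 + j log L)]³ ≤ 𝒪(1)"* (TeX L2245–2246) omits the exponent `r` that its own previous line *"r_{k−j} ≤ (1 + j log
L)^r r_k"* (TeX L2241) produces; with the exponent the bracket is `≤ 3·4^r·r!` for `log L ≥ 1` (`series_le`), still
`𝒪(1)` in the print's sense for the fixed `r` — a Dimock-internal slip, recorded for the cell's T-G22 list (records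
only).  (v) LARGENESS, EXPLICIT: `log L ≥ 1` (as `HistorySum.LargeLog.logL`; TeX L2272) and `−log λ ≥ 1` (Theorem 1, TeX
L267: *"Let 0 < λ < e^{−1}"*; `LargeLog.ell₀` has `−log λ ≥ 2`) — `Large`; with them `−log λ_k ≥ 1` at every level, which
TeX L2241 uses tacitly.  (vi) TeX L2310 *"drop all conditions on P_j, Q_j, R_j except that they are unions of
L^{−(𝖭−j)}M cubes □ contained in Θ"* presupposes `Λ^c_j ⊆ Λ^c_{j+1}` (so that every region lies in `Θ = Λ^c_{𝖭+1}`);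
(understood) alone does not give it (`(Λ̄_j)^c` drops the blocks partly inside `Λ^c_j`), Part 7 gives it under
(N1)–(N2), which hold for `λ` small at fixed `L, r` (Part 8 `nesting_of_small`: `L ≤ (−log λ)^r`, `(1 + log
L/(−log λ))^r ≤ 2`, `log L ≥ 1`) — recorded as a Dimock-internal tacit step (T-G22, records only); it bears on the
INDEX SET of (randall) only: `stability_of_regions` asks (randall) on `regionHist Θ` (free histories over `Θ` with top
region `Θ`), which contains the print's index set (nested histories with `Λ^c_{𝖭+1} = Θ`) by Part 8
`mem_regionHist_of_nested` — a THEOREM here, the print's sentence L2310 — and (randall)'s summands are positive, so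
the asked shape is implied by the printed one.  (vii) The iterated block maps `cz_{𝖭} ∘ ⋯ ∘ cz_j` ARE `HistorySum.fine`'s
one-shot block map `tcoarse (L^{𝖭−j}) n` followed to `Θ` (Part 8 `tcoarse_cz`, `mem_fine_iff_iter`; v1 left this
unformalised).
(viii) The cell's torus-model conventions D-pv22.1 / D-pv22g2.1 apply as in the sibling modules; tiny tori (fewer
cubes per direction than a ball's side) are allowed — balls then wrap, all statements are inclusions / upper bounds.

**What is NOT claimed.**  (randall), (under), (stingray) remain hypothesis shapes (the analytic §§3.1–3.4: characteristic
functions, small factors, Gaussian integrals); the side conditions of (understood) on the histories (`P_{j+1} ⊂ Λ̄_j`,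
`Q_{j+1} ⊂ Ω^♮_{j+1}`, `R_{j+1} ⊂ Ω_{j+1}`) are not imposed (Lemma 14 holds without them); Theorem 1 (the flow) is not
touched; nothing about the fields.  Value = kernel closure of the template's last quoted combinatorial/geometric leaf of
[Dimock2013BalabanIII] §3 over the cell's own torus model, NOT summit progress (YM₄ on T⁴ / infinite volume / mass gap are
elsewhere and out of scope).

Cell records: TEMPLATE.md §4.3 (row D3 §3.5), §15.2, §20 (T-G22 words); GAPS.md C-tmpl16-1 (`HistorySum`) and this
module's row C-tmpl17-1; unit `b2b-balaban-template` gen 17, journal claim D3-UGH2-REGIONVOLUME-KERNEL.  NEW leaf;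
imports `…Dimock2011to13.HistorySum` only (this lineage, p184763; through it `…HoleSummability`, `…ThreeSortedResummation`,
`…Phi43PolymerRepresentation`, `…Reblocking` and pv22's `TreeLengthTorus*` with `tcoarse`, `proj`, `natLift`, `period`,
pv11's `B13ScaleTransfer.coarse` / `coarse_eq_iff`); sub-namespace `…Dimock2011to13.RegionVolume`; modifies nothing.
v1 = p185091 (commit 6d094c620ca4).  v1.1 (same seat): APPEND-ONLY Part 8 (the index set of (randall) under nesting;
(N1)–(N2) from smallness) + header/docstring words (Part 8 bullet, readings (vi)–(vii) sharpened, the placement note of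
Part 7); the declarations and proofs of v1 are byte-identical.  v1.2 (same seat): DOCSTRING-ONLY — the empty-index-set
clause at `regionHist` / `stability_of_regions` (cross-reads C-pv01-73 advisory A2, C-ref6-127); code byte-identical.
-/

noncomputable section

open Real Finset
open Literature.MathematicalPhysics.QuantumFieldTheory.Balaban1983to89
open Literature.MathematicalPhysics.QuantumFieldTheory.Balaban1983to89.B13ScaleTransfer (Pt coarse coarse_eq_iff)
open Literature.MathematicalPhysics.QuantumFieldTheory.Balaban1983to89.TreeLengthTorus
open Literature.MathematicalPhysics.QuantumFieldTheory.Balaban1983to89.TreeLengthTorusGeometry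
  (period proj_add_period exists_period_of_proj_eq)
open Literature.MathematicalPhysics.QuantumFieldTheory.Balaban1983to89.TreeLengthTorusTransfer (tcoarse coarse_add_period)

namespace Literature.MathematicalPhysics.QuantumFieldTheory.Dimock2011to13.RegionVolume

open Literature.MathematicalPhysics.QuantumFieldTheory.Dimock2011to13.HistorySum

/-! ## Part 1. Sup-norm boxes, balls and enlargements on the torus `(ℤ/N′)^d` -/

section Torus

variable {d : ℕ} {N' : ℕ}

/-- The integer box `{v ∈ ℤ^d : |v_i| ≤ s}` (side `2s+1`). [folklore] -/
def box (d s : ℕ) : Finset (Pt d) := Fintype.piFinset fun _ => Finset.Icc (-(s : ℤ)) s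

/-- Membership in the box. [folklore] -/
theorem mem_box {s : ℕ} {v : Pt d} : v ∈ box d s ↔ ∀ i, -(s : ℤ) ≤ v i ∧ v i ≤ s := by
  simp [box, Fintype.mem_piFinset]

/-- `|box| = (2s+1)^d`. [folklore] -/
theorem card_box (d s : ℕ) : (box d s).card = (2 * s + 1) ^ d := by
  rw [box, Fintype.card_piFinset]
  simp only [Int.card_Icc, prod_const, card_univ, Fintype.card_fin]
  congr 1
  omega

/-- `0 ∈ box`. [folklore] -/
theorem zero_mem_box (s : ℕ) : (0 : Pt d) ∈ box d s :=
  mem_box.2 fun _ => ⟨by simp, by simp⟩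

/-- Boxes grow with the radius. [folklore] -/
theorem box_mono {s s' : ℕ} (h : s ≤ s') : box d s ⊆ box d s' := fun v hv =>
  mem_box.2 fun i => ⟨by linarith [(mem_box.1 hv i).1, show (s : ℤ) ≤ s' by exact_mod_cast h],
    by linarith [(mem_box.1 hv i).2, show (s : ℤ) ≤ s' by exact_mod_cast h]⟩

/-- Sums of box vectors (sup-norm triangle inequality). [folklore] -/
theorem add_mem_box {s s' : ℕ} {v w : Pt d} (hv : v ∈ box d s) (hw : w ∈ box d s') :
    v + w ∈ box d (s + s') := by
  refine mem_box.2 fun i => ?_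
  have h1 := mem_box.1 hv i
  have h2 := mem_box.1 hw i
  simp only [Pi.add_apply, Nat.cast_add]
  constructor <;> linarith

/-- `proj` is additive. [folklore] -/
theorem proj_add (x y : Pt d) : proj N' (x + y) = proj N' x + proj N' y := by
  funext i
  simp [proj, Int.cast_add]

/-- THE SUP-NORM BALL OF RADIUS `s` (in cubes) around the cube `x` of the torus: the classes `x + v`, `v ∈ ℤ^d`,
`|v_i| ≤ s` — the cube *"□^{∼n} … □ enlarged by n layers of M blocks"* of [Dimock2013BalabanII] TeX L1849, on the
periodic carrier (wrap-around included). [cite: Dimock2013BalabanII, §3.1.5 (arXiv:1212.5562v2 TeX L1849–1851)] -/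
def tball (x : TPt d N') (s : ℕ) : Finset (TPt d N') := (box d s).image fun v => x + proj N' v

/-- Membership in a ball. [folklore] -/
theorem mem_tball {x y : TPt d N'} {s : ℕ} : y ∈ tball x s ↔ ∃ v ∈ box d s, y = x + proj N' v := by
  simp only [tball, mem_image]
  constructor
  · rintro ⟨v, hv, rfl⟩; exact ⟨v, hv, rfl⟩
  · rintro ⟨v, hv, rfl⟩; exact ⟨v, hv, rfl⟩

/-- The centre is in the ball. [folklore] -/
theorem self_mem_tball (x : TPt d N') (s : ℕ) : x ∈ tball x s :=
  mem_tball.2 ⟨0, zero_mem_box s, by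
    have : proj N' (0 : Pt d) = 0 := by funext i; simp [proj]
    rw [this, add_zero]⟩

/-- Balls grow with the radius. [folklore] -/
theorem tball_mono {x : TPt d N'} {s s' : ℕ} (h : s ≤ s') : tball x s ⊆ tball x s' := fun y hy => by
  obtain ⟨v, hv, rfl⟩ := mem_tball.1 hy
  exact mem_tball.2 ⟨v, box_mono h hv, rfl⟩

/-- Balls compose additively in the radius (sup-norm triangle inequality). [folklore] -/
theorem mem_tball_add {x y z : TPt d N'} {s s' : ℕ} (hy : y ∈ tball x s) (hz : z ∈ tball y s') :
    z ∈ tball x (s + s') := by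
  obtain ⟨v, hv, rfl⟩ := mem_tball.1 hy
  obtain ⟨w, hw, rfl⟩ := mem_tball.1 hz
  exact mem_tball.2 ⟨v + w, add_mem_box hv hw, by rw [proj_add, add_assoc]⟩

/-- `|□^{∼s}| ≤ (2s+1)^d` on the torus. [folklore] -/
theorem card_tball_le (x : TPt d N') (s : ℕ) : (tball x s).card ≤ (2 * s + 1) ^ d :=
  card_image_le.trans (card_box d s).le

/-- THE ENLARGEMENT `X^{∼s}` BY `s` LAYERS OF CUBES — [Dimock2013BalabanII] TeX L1849–1851, verbatim: *"We also define
□^{∼n} to be □ enlarged by n layers of M blocks, and more generally X^{∼n} = ⋃_{□⊂X} □^{∼n} = X enlarged by n layers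
of M blocks"*; TeX L1864–1867: *"X^* = X enlarged by [r_k] layers of M blocks = X^{∼[r_k]} … X^{2*} = X^{**}, X^{3*} =
X^{***}, etc."* (so `X^{5*} = X^{∼5[r_k]}`, `enl_enl_subset`); TeX L1879–1880: *"If X is specified as a union of
L^{−(k−j)}M blocks, then the enlargements also are taken with L^{−(k−j)}M blocks."* [cite: Dimock2013BalabanII, §3.1.5 (arXiv:1212.5562v2 TeX L1849–1880)] -/
def enl (s : ℕ) (X : Finset (TPt d N')) : Finset (TPt d N') := X.biUnion fun x => tball x s

/-- Membership in an enlargement. [folklore] -/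
theorem mem_enl {s : ℕ} {X : Finset (TPt d N')} {y : TPt d N'} : y ∈ enl s X ↔ ∃ x ∈ X, y ∈ tball x s := by
  simp [enl]

/-- `X ⊆ X^{∼s}`. [folklore] -/
theorem subset_enl (s : ℕ) (X : Finset (TPt d N')) : X ⊆ enl s X := fun x hx =>
  mem_enl.2 ⟨x, hx, self_mem_tball x s⟩

/-- `X ⊆ Y ⇒ X^{∼s} ⊆ Y^{∼s}`. [folklore] -/
theorem enl_mono {s : ℕ} {X Y : Finset (TPt d N')} (h : X ⊆ Y) : enl s X ⊆ enl s Y := fun y hy => by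
  obtain ⟨x, hx, hyx⟩ := mem_enl.1 hy
  exact mem_enl.2 ⟨x, h hx, hyx⟩

/-- `(X ∪ Y)^{∼s} = X^{∼s} ∪ Y^{∼s}` ([Dimock2013BalabanII] TeX L1851: the enlargement is a union over the cubes). [folklore] -/
theorem enl_union (s : ℕ) (X Y : Finset (TPt d N')) : enl s (X ∪ Y) = enl s X ∪ enl s Y := by
  classical
  exact Finset.union_biUnion

/-- `(X^{∼s})^{∼s′} ⊆ X^{∼(s+s′)}`. [folklore] -/
theorem enl_enl_subset (s s' : ℕ) (X : Finset (TPt d N')) : enl s' (enl s X) ⊆ enl (s + s') X := fun z hz => by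
  obtain ⟨y, hy, hzy⟩ := mem_enl.1 hz
  obtain ⟨x, hx, hyx⟩ := mem_enl.1 hy
  exact mem_enl.2 ⟨x, hx, mem_tball_add hyx hzy⟩

/-- The enlargement of a union of balls is inside the union of the enlarged balls. [folklore] -/
theorem enl_biUnion_tball_subset (s : ℕ) (C : Finset (TPt d N')) (ρ : ℕ) :
    enl s (C.biUnion fun c => tball c ρ) ⊆ C.biUnion fun c => tball c (ρ + s) := fun z hz => by
  obtain ⟨y, hy, hzy⟩ := mem_enl.1 hz
  obtain ⟨c, hc, hyc⟩ := mem_biUnion.1 hy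
  exact mem_biUnion.2 ⟨c, hc, mem_tball_add hyc hzy⟩

/-- `X^{∼s}` for `X ⊆` a union of balls. [folklore] -/
theorem enl_subset_biUnion_of_subset {s ρ : ℕ} {X C : Finset (TPt d N')}
    (h : X ⊆ C.biUnion fun c => tball c ρ) : enl s X ⊆ C.biUnion fun c => tball c (ρ + s) :=
  (enl_mono h).trans (enl_biUnion_tball_subset s C ρ)

/-- `X^{∼s} = ⋃_{x∈X} x^{∼s}` is itself a union of balls. [folklore] -/
theorem enl_eq_biUnion (s : ℕ) (X : Finset (TPt d N')) : enl s X = X.biUnion fun c => tball c s := rfl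

end Torus

/-! ## Part 2. The block map between two tori of the tower and how it moves balls -/

section Coarsen

variable {d : ℕ}

/-- THE BLOCK MAP from the torus with `Nf` cubes per direction to the torus with `Nc` cubes per direction, blocks of
side `Ls` (meaningful for `Nf = Ls · Nc`, where it IS pv22's `TreeLengthTorusTransfer.tcoarse Ls Nc`,
`czmap_eq_tcoarse`; stated for an arbitrary fine modulus so that it can be applied along the tower
`TPt d (L^{N−j} · n)` of `HistorySum.Hist` without transport): cube `ā ↦` block `⌊a/Ls⌋ mod Nc` of the standard lift.
For `Ls = 1` it is the identity up to the carrier (`coarse 1 = id`).  [Dimock2013BalabanII] TeX L2708: *"Let Λ̄_k be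
the union of all LM cubes intersecting Λ_k"* — the LM cubes are the blocks. [cite: Dimock2013BalabanII, §3.5 (arXiv:1212.5562v2 TeX L2708)] -/
def czmap (Ls Nc : ℕ) {Nf : ℕ} [NeZero Nf] (a : TPt d Nf) : TPt d Nc := proj Nc (coarse Ls (natLift a))

/-- THE COARSE CUBES INSIDE `X`: the blocks all of whose cubes lie in `X` — for `X = Λ_j^c` this is `(Λ̄_j)^c`,
[Dimock2013BalabanII] TeX L2708, verbatim: *"Let Λ̄_k be the union of all LM cubes intersecting Λ_k."* (so a block
is in `Λ̄_k^c` iff it does not meet `Λ_k`, iff all its cubes are in `Λ_k^c`). [cite: Dimock2013BalabanII, §3.5 (arXiv:1212.5562v2 TeX L2708)] -/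
def cinside (Ls Nc : ℕ) {Nf : ℕ} [NeZero Nf] [NeZero Nc] (X : Finset (TPt d Nf)) : Finset (TPt d Nc) := by
  classical
  exact univ.filter fun b => ∀ a : TPt d Nf, czmap Ls Nc a = b → a ∈ X

/-- Membership in `(Λ̄)^c`. [folklore] -/
theorem mem_cinside {Ls Nc Nf : ℕ} [NeZero Nf] [NeZero Nc] {X : Finset (TPt d Nf)} {b : TPt d Nc} :
    b ∈ cinside Ls Nc X ↔ ∀ a : TPt d Nf, czmap Ls Nc a = b → a ∈ X := by
  classical
  simp [cinside]

variable {Ls Nc : ℕ} [NeZero Ls] [NeZero Nc]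

/-- On the tower modulus `Ls · Nc` the block map is `tcoarse`. [folklore] -/
theorem czmap_eq_tcoarse (a : TPt d (Ls * Nc)) : czmap Ls Nc a = tcoarse Ls Nc a := rfl

/-- The block map is induced by `coarse Ls` on the universal cover (pv22's `tcoarse_proj`). [folklore] -/
theorem czmap_proj {Nf : ℕ} [NeZero Nf] (hmod : Nf = Ls * Nc) (x : Pt d) :
    czmap Ls Nc (proj Nf x) = proj Nc (coarse Ls x) := by
  subst hmod
  exact TreeLengthTorusTransfer.tcoarse_proj x

omit [NeZero Ls] in
/-- `coarse Ls (Ls • x) = x`. [folklore] -/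
theorem coarse_smul (hLs : 0 < Ls) (x : Pt d) : coarse Ls (fun i => (Ls : ℤ) * x i) = x := by
  funext i
  have hL' : (Ls : ℤ) ≠ 0 := by exact_mod_cast hLs.ne'
  exact Int.mul_ediv_cancel_left _ hL'

/-- Every block is the block of some cube (the block map is onto). [folklore] -/
theorem czmap_surjective {Nf : ℕ} [NeZero Nf] (hmod : Nf = Ls * Nc) (b : TPt d Nc) :
    ∃ a : TPt d Nf, czmap Ls Nc a = b := by
  have hLs : 0 < Ls := Nat.pos_of_ne_zero (NeZero.ne Ls)
  refine ⟨proj Nf (fun i => (Ls : ℤ) * natLift b i), ?_⟩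
  rw [czmap_proj hmod, coarse_smul hLs, proj_natLift]

/-- THE BLOCK MAP MOVES BALLS TO BALLS: the blocks met by `x^{∼s}` lie in `(block of x)^{∼(⌊s/Ls⌋+1)}` — the discrete
form of [Dimock2013BalabanIII] TeX L2224–2225 *"The actual Λ^c_{k+1} … is obtained by scaling down by L^{−1}. Thus it is
covered by the cubes in (claim2) and (newnew) with widths scaled down by L^{−1}"* together with TeX L2207–2208 *"Each
cube in this covering is enlarged to a cube which is a union of standard LM cubes (adding less than 2LM to the
width)"* (the `+1`). [cite: Dimock2013BalabanIII, §3.5 proof of Lemma 14 (arXiv:1304.0705v1 TeX L2202–2226)] -/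
theorem czmap_mem_tball {Nf : ℕ} [NeZero Nf] (hmod : Nf = Ls * Nc) {x a : TPt d Nf} {s : ℕ}
    (ha : a ∈ tball x s) : czmap Ls Nc a ∈ tball (czmap Ls Nc x) (s / Ls + 1) := by
  have hLs : 0 < Ls := Nat.pos_of_ne_zero (NeZero.ne Ls)
  have hLz : (0 : ℤ) < Ls := by exact_mod_cast hLs
  obtain ⟨v, hv, rfl⟩ := mem_tball.1 ha
  set p : Pt d := natLift x with hp
  set b : Pt d := coarse Ls p with hb
  set b' : Pt d := coarse Ls (p + v) with hb'
  have hx : x = proj Nf p := by rw [hp, proj_natLift]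
  have h1 : czmap Ls Nc (x + proj Nf v) = proj Nc b' := by
    rw [hx, ← proj_add, czmap_proj hmod]
  have h2 : czmap Ls Nc x = proj Nc b := by rw [hx, czmap_proj hmod]
  rw [h1, h2]
  refine mem_tball.2 ⟨b' - b, ?_, by rw [← proj_add]; congr 1; abel⟩
  -- the box estimate, coordinatewise, from the sandwich `Ls·b ≤ p < Ls·(b+1)`
  have hB := (coarse_eq_iff hLs p b).1 rfl
  have hB' := (coarse_eq_iff hLs (p + v) b').1 rfl
  -- `s < Ls · (s/Ls + 1)`
  have hn : s < Ls * (s / Ls + 1) := by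
    have := Nat.lt_div_mul_add (a := s) hLs
    rw [Nat.mul_add, Nat.mul_one, Nat.mul_comm]
    exact this
  have hq : (s : ℤ) < (Ls : ℤ) * ((s / Ls : ℕ) + 1) := by exact_mod_cast hn
  refine mem_box.2 fun i => ?_
  obtain ⟨h1i, h2i⟩ := hB i
  obtain ⟨h3i, h4i⟩ := hB' i
  have hvi := mem_box.1 hv i
  simp only [Pi.add_apply] at h3i h4i
  simp only [Pi.sub_apply, Nat.cast_add, Nat.cast_one]
  constructor
  · -- lower: Ls·(b i − b' i − 1) < s
    have hlt : (Ls : ℤ) * (b i - b' i - 1) < (Ls : ℤ) * ((s / Ls : ℕ) + 1) := by nlinarith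
    have := lt_of_mul_lt_mul_left hlt hLz.le
    linarith
  · -- upper: Ls·(b' i − b i − 1) < s
    have hlt : (Ls : ℤ) * (b' i - b i - 1) < (Ls : ℤ) * ((s / Ls : ℕ) + 1) := by nlinarith
    have := lt_of_mul_lt_mul_left hlt hLz.le
    linarith

/-- Images of unions of balls under the block map. [folklore] -/
theorem image_biUnion_tball_subset {Nf : ℕ} [NeZero Nf] (hmod : Nf = Ls * Nc) (C : Finset (TPt d Nf)) (ρ : ℕ) :
    (C.biUnion fun c => tball c ρ).image (czmap Ls Nc) ⊆
      (C.image (czmap Ls Nc)).biUnion fun c => tball c (ρ / Ls + 1) := by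
  classical
  intro b hb
  obtain ⟨a, ha, rfl⟩ := mem_image.1 hb
  obtain ⟨c, hc, hac⟩ := mem_biUnion.1 ha
  exact mem_biUnion.2 ⟨czmap Ls Nc c, mem_image_of_mem _ hc, czmap_mem_tball hmod hac⟩

/-- `(Λ̄)^c ⊆` the blocks met by `Λ^c` (every block has a cube). [folklore] -/
theorem cinside_subset_image {Nf : ℕ} [NeZero Nf] (hmod : Nf = Ls * Nc) (X : Finset (TPt d Nf)) :
    cinside Ls Nc X ⊆ X.image (czmap Ls Nc) := by
  classical
  intro b hb
  obtain ⟨a, rfl⟩ := czmap_surjective hmod b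
  exact mem_image.2 ⟨a, mem_cinside.1 hb a rfl, rfl⟩


/-- A ball of radius `0` is the centre. [folklore] -/
theorem eq_of_mem_tball_zero {N' : ℕ} {x a : TPt d N'} (ha : a ∈ tball x 0) : a = x := by
  obtain ⟨v, hv, rfl⟩ := mem_tball.1 ha
  have hv0 : v = 0 := by
    funext i
    have := mem_box.1 hv i
    simp only [Nat.cast_zero, neg_zero] at this
    exact le_antisymm this.2 this.1
  rw [hv0]
  have : proj N' (0 : Pt d) = 0 := by funext i; simp [proj]
  rw [this, add_zero]

omit [NeZero Nc] in
/-- THE CUBES OF ONE BLOCK LIE IN A BALL OF RADIUS `Ls − 1` around any of them: if `ā`, `ȳ` have the same block then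
`ā ∈ ȳ^{∼(Ls−1)}`. [folklore] -/
theorem mem_tball_of_czmap_eq {Nf : ℕ} [NeZero Nf] (hmod : Nf = Ls * Nc) {a y : TPt d Nf}
    (h : czmap Ls Nc a = czmap Ls Nc y) : a ∈ tball y (Ls - 1) := by
  have hLs : 0 < Ls := Nat.pos_of_ne_zero (NeZero.ne Ls)
  set pa : Pt d := natLift a with hpa
  set py : Pt d := natLift y with hpy
  -- the two blocks differ by a period of the coarse torus
  obtain ⟨k, hk⟩ : ∃ k : Pt d, coarse Ls pa = coarse Ls py + period Nc k :=
    exists_period_of_proj_eq (N := Nc) h.symm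
  set py' : Pt d := py + period Nf k with hpy'
  have hcoarse : coarse Ls py' = coarse Ls pa := by
    rw [hk, hpy', hmod, coarse_add_period hLs Nc py k]
  have hB := (coarse_eq_iff hLs pa (coarse Ls pa)).1 rfl
  have hB' := (coarse_eq_iff hLs py' (coarse Ls pa)).1 hcoarse
  have hya : a = y + proj Nf (pa - py') := by
    have e1 : proj Nf pa = a := by rw [hpa, proj_natLift]
    have e2 : proj Nf py' = y := by rw [hpy', proj_add_period, hpy, proj_natLift]
    rw [← e2, ← proj_add, add_sub_cancel, e1]
  rw [hya]
  refine mem_tball.2 ⟨pa - py', mem_box.2 fun i => ?_, rfl⟩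
  have hc : ((Ls - 1 : ℕ) : ℤ) = (Ls : ℤ) - 1 := by
    rw [Nat.cast_sub (Nat.succ_le_of_lt hLs), Nat.cast_one]
  obtain ⟨h1, h2⟩ := hB i
  obtain ⟨h3, h4⟩ := hB' i
  simp only [Pi.sub_apply, hc]
  constructor <;> linarith

end Coarsen

/-! ## Part 3. Unions of balls over levels (the shape of the covering (claim)) -/

section UCover

variable {d N' : ℕ}

/-- A union of balls with centre sets `C i` and radii `ρ i` over the levels `i ≤ k` — the shape of the covering
(claim) of [Dimock2013BalabanIII] TeX L2181–2190 (*"|𝒞_i| cubes of width ≤ M(…)"*, one family per level `i`). [cite: Dimock2013BalabanIII, §3.5 proof of Lemma 14 eq. (claim) (arXiv:1304.0705v1 TeX L2181–2190)] -/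
def ucover (k : ℕ) (C : ℕ → Finset (TPt d N')) (ρ : ℕ → ℕ) : Finset (TPt d N') :=
  (range (k + 1)).biUnion fun i => (C i).biUnion fun c => tball c (ρ i)

/-- Membership in a union of balls. [folklore] -/
theorem mem_ucover {k : ℕ} {C : ℕ → Finset (TPt d N')} {ρ : ℕ → ℕ} {y : TPt d N'} :
    y ∈ ucover k C ρ ↔ ∃ i, i ≤ k ∧ ∃ c ∈ C i, y ∈ tball c (ρ i) := by
  simp only [ucover, mem_biUnion, mem_range, Nat.lt_succ_iff]

/-- Enlarging a union of balls by `s` layers enlarges the radii by `s`. [folklore] -/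
theorem enl_ucover_subset (s k : ℕ) (C : ℕ → Finset (TPt d N')) (ρ : ℕ → ℕ) :
    enl s (ucover k C ρ) ⊆ ucover k C (fun i => ρ i + s) := fun z hz => by
  obtain ⟨y, hy, hzy⟩ := mem_enl.1 hz
  obtain ⟨i, hi, c, hc, hyc⟩ := mem_ucover.1 hy
  exact mem_ucover.2 ⟨i, hi, c, hc, mem_tball_add hyc hzy⟩

/-- Monotonicity of a union of balls in the centre sets and the radii, levelwise. [folklore] -/
theorem ucover_mono {k : ℕ} {C C' : ℕ → Finset (TPt d N')} {ρ ρ' : ℕ → ℕ}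
    (hC : ∀ i ≤ k, C i ⊆ C' i) (hρ : ∀ i ≤ k, ρ i ≤ ρ' i) : ucover k C ρ ⊆ ucover k C' ρ' := fun y hy => by
  obtain ⟨i, hi, c, hc, hyc⟩ := mem_ucover.1 hy
  exact mem_ucover.2 ⟨i, hi, c, hC i hi hc, tball_mono (hρ i hi) hyc⟩

/-- One more level. [folklore] -/
theorem ucover_subset_succ (k : ℕ) (C : ℕ → Finset (TPt d N')) (ρ : ℕ → ℕ) :
    ucover k C ρ ⊆ ucover (k + 1) C ρ := fun y hy => by
  obtain ⟨i, hi, c, hc, hyc⟩ := mem_ucover.1 hy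
  exact mem_ucover.2 ⟨i, Nat.le_succ_of_le hi, c, hc, hyc⟩

/-- The top level's balls are in the union. [folklore] -/
theorem biUnion_subset_ucover (k : ℕ) (C : ℕ → Finset (TPt d N')) (ρ : ℕ → ℕ) :
    ((C k).biUnion fun c => tball c (ρ k)) ⊆ ucover k C ρ := fun y hy => by
  obtain ⟨c, hc, hyc⟩ := mem_biUnion.1 hy
  exact mem_ucover.2 ⟨k, le_rfl, c, hc, hyc⟩

/-- The volume of a union of balls: `≤ Σ_{i≤k} |C_i| (2ρ_i+1)^d` — the counting of [Dimock2013BalabanIII] TeX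
L2229–2238 (*"It follows that Vol(Λ_k^c) ≤ M³(…)³|𝒞₀| + … + M³(1 + 22[r_k])³|𝒞_k|"*), per cube of side `2ρ+1`. [cite: Dimock2013BalabanIII, §3.5 proof of Lemma 14 (arXiv:1304.0705v1 TeX L2229–2238)] -/
theorem card_ucover_le (k : ℕ) (C : ℕ → Finset (TPt d N')) (ρ : ℕ → ℕ) :
    (ucover k C ρ).card ≤ ∑ i ∈ range (k + 1), (C i).card * (2 * ρ i + 1) ^ d := by
  unfold ucover
  refine card_biUnion_le.trans (sum_le_sum fun i _ => ?_)
  refine card_biUnion_le.trans ?_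
  calc ∑ c ∈ C i, (tball c (ρ i)).card ≤ ∑ _c ∈ C i, (2 * ρ i + 1) ^ d :=
        sum_le_sum fun c _ => card_tball_le c (ρ i)
    _ = (C i).card * (2 * ρ i + 1) ^ d := by rw [sum_const, smul_eq_mul]

/-- The block map takes a union of balls into the union of balls around the image centres, radii `⌊ρ_i/Ls⌋ + 1`. [folklore] -/
theorem image_ucover_subset {Ls Nc : ℕ} [NeZero Ls] [NeZero Nc] [NeZero N'] (hmod : N' = Ls * Nc) (k : ℕ)
    (C : ℕ → Finset (TPt d N')) (ρ : ℕ → ℕ) :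
    (ucover k C ρ).image (czmap Ls Nc) ⊆
      ucover k (fun i => (C i).image (czmap Ls Nc)) (fun i => ρ i / Ls + 1) := by
  classical
  intro b hb
  obtain ⟨y, hy, rfl⟩ := mem_image.1 hb
  obtain ⟨i, hi, c, hc, hyc⟩ := mem_ucover.1 hy
  exact mem_ucover.2 ⟨i, hi, czmap Ls Nc c, mem_image_of_mem _ hc, czmap_mem_tball hmod hyc⟩

end UCover

/-! ## Part 4. The region recursion (understood) on the tower of tori of `HistorySum.Hist`, TYPED -/

section Regions

variable {d L n N : ℕ} [NeZero L] [NeZero n]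

/-- THE SCALE FACTOR OF THE STEP `j → j+1`: the regions of level `j ≤ 𝖭` are unions of `L^{−(𝖭−j)}M` cubes and those of
level `𝖭+1` of `M` cubes ([Dimock2013BalabanIII] TeX L1652: *"Each of these is a union of L^{−(𝖭−j)}M cubes in 𝕋^{−𝖭}_𝖬
(except R_{𝖭+1} is still M cubes)"*), so the step `j → j+1` coarsens by `L` for `j < 𝖭` and not at all for the last
step `𝖭 → 𝖭+1` (TeX L431 *"Ω_{𝖭+1} ≡ Λ_𝖭^{5♮}"*, L795 *"Λ^c_{𝖭+1} = (Ω^c_{𝖭+1})^{5*} ∪ R^{5*}_{𝖭+1}"*, both in `M`-cubes of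
`𝕋^{−𝖭}_𝖬`). [cite: Dimock2013BalabanIII, §3.2 (arXiv:1304.0705v1 TeX L1651–1653)] -/
def Lstep (L N j : ℕ) : ℕ := if j < N then L else 1

/-- The scale factor is positive. [folklore] -/
theorem Lstep_pos (N j : ℕ) : 0 < Lstep L N j := by
  unfold Lstep
  split
  · exact Nat.pos_of_ne_zero (NeZero.ne L)
  · exact Nat.one_pos

/-- The scale factor is non-zero (instance for the block-map lemmas). [folklore] -/
instance lstep_neZero (N j : ℕ) : NeZero (Lstep L N j) := ⟨(Lstep_pos (L := L) N j).ne'⟩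

omit [NeZero L] in
/-- `Lstep_j = L` for `j < 𝖭`. [folklore] -/
theorem Lstep_of_lt {N j : ℕ} (h : j < N) : Lstep L N j = L := if_pos h

omit [NeZero L] in
/-- `Lstep_j = 1` from `j = 𝖭` on. [folklore] -/
theorem Lstep_of_le {N j : ℕ} (h : N ≤ j) : Lstep L N j = 1 := if_neg (not_lt.2 h)

/-- The tower identity: `L^{𝖭−j}·n = Lstep_j · (L^{𝖭−(j+1)}·n)`. [folklore] -/
theorem tower_mod (L n N j : ℕ) : L ^ (N - j) * n = Lstep L N j * (L ^ (N - (j + 1)) * n) := by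
  unfold Lstep
  split
  · rename_i h
    have e : N - j = N - (j + 1) + 1 := by omega
    rw [e, pow_succ]
    ring
  · rename_i h
    have e1 : N - j = 0 := by omega
    have e2 : N - (j + 1) = 0 := by omega
    rw [e1, e2]
    ring

/-- THE BLOCK MAP OF THE STEP `j → j+1` of the tower `TPt d (L^{𝖭−j}·n)`. [cite: Dimock2013BalabanIII, §3.2 (arXiv:1304.0705v1 TeX L1651–1653)] -/
def cz (L n N j : ℕ) [NeZero L] [NeZero n] (a : TPt d (L ^ (N - j) * n)) : TPt d (L ^ (N - (j + 1)) * n) :=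
  czmap (Lstep L N j) (L ^ (N - (j + 1)) * n) a

/-- THE REGION OF LETTER `X ∈ {P, Q, R}` AT LEVEL `j` of a history of `HistorySum.Hist` (levels `0 … 𝖭+1`; empty
beyond). [cite: Dimock2013BalabanIII, §3.2 (arXiv:1304.0705v1 TeX L1651–1653)] -/
def slot (h : Hist d L n N) (j : ℕ) (X : Fin 3) : Finset (TPt d (L ^ (N - j) * n)) :=
  if hj : j < N + 2 then h ⟨j, hj⟩ X else ∅

/-- `𝒞_j` AS A SET OF CUBES: `P_j ∪ Q_j ∪ R_j` — [Dimock2013BalabanIII] TeX L2166: *"Let 𝒞_j be the set of all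
L^{−(k−j)}M cubes in P_j ∪ Q_j ∪ R_j."* [cite: Dimock2013BalabanIII, §3.5 (arXiv:1304.0705v1 TeX L2164–2170)] -/
def cubes (h : Hist d L n N) (j : ℕ) : Finset (TPt d (L ^ (N - j) * n)) := slot h j 0 ∪ slot h j 1 ∪ slot h j 2

/-- The regions on the levels `0 … 𝖭+1` are the history's. [folklore] -/
theorem slot_of_lt (h : Hist d L n N) {j : ℕ} (hj : j < N + 2) (X : Fin 3) : slot h j X = h ⟨j, hj⟩ X := dif_pos hj

/-- `P_j, Q_j, R_j ⊆ 𝒞_j`. [folklore] -/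
theorem slot_subset_cubes (h : Hist d L n N) (j : ℕ) (X : Fin 3) : slot h j X ⊆ cubes h j := by
  intro x hx
  unfold cubes
  rw [mem_union, mem_union]
  fin_cases X
  · exact Or.inl (Or.inl hx)
  · exact Or.inl (Or.inr hx)
  · exact Or.inr hx

/-- `|𝒞_j| = ucnt h j` on the levels `0 … 𝖭+1` (`HistorySum.ucnt`, stated there at `d = 3`), and `𝒞_j = ∅`
beyond. [folklore] -/
theorem card_cubes_of_lt (h : Hist 3 L n N) {j : ℕ} (hj : j < N + 2) :
    (cubes h j).card = ucnt h ⟨j, hj⟩ := by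
  unfold cubes ucnt
  rw [slot_of_lt h hj, slot_of_lt h hj, slot_of_lt h hj]
  rfl

/-- No regions beyond level `𝖭+1`. [folklore] -/
theorem cubes_of_le (h : Hist d L n N) {j : ℕ} (hj : N + 2 ≤ j) : cubes h j = ∅ := by
  unfold cubes slot
  rw [dif_neg (by omega), dif_neg (by omega), dif_neg (by omega)]
  simp

/-- ONE STEP OF (understood) GIVEN THE PREVIOUS COARSE COMPLEMENT: from `B = (Λ̄_{j−1})^c` (as blocks of level `j`) and
the level-`j` regions, with `s = 5[r_j]` layers: `Ω^c_j = B^{5*} ∪ P_j^{5*}` and `Λ^c_j = (Ω^c_j)^{5*} ∪ Q_j^{5*} ∪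
R_j^{5*}` — [Dimock2013BalabanIII] eq. (understood), TeX L1655–1660, verbatim: *"Ω^c_{j+1} = (Λ̄_j)^{c,5*} ∪ P^{5*}_{j+1}
(P_{j+1} ⊂ Λ̄_j), Λ^c_{j+1} = (Ω^c_{j+1})^{5*} ∪ Q^{5*}_{j+1} ∪ R^{5*}_{j+1} (Q_{j+1} ⊂ Ω^♮_{j+1}, R_{j+1} ⊂ Ω_{j+1})"*;
[Dimock2013BalabanII] TeX L2725–2726: *"Here the *, ♮ operations refer to adding or deleting layers of LM-cubes. In
generating Ω_{k+1}^c from (Λ̄_k)^c we add at least 5[r_{k+1}] layers of LM-cubes"*.  The side conditions in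
parentheses restrict the histories summed over and play no role in Lemma 14; they are not imposed. [cite: Dimock2013BalabanIII, §3.2 eq. (understood) (arXiv:1304.0705v1 TeX L1654–1662)] -/
def omegaC (t : ℕ → ℕ) (h : Hist d L n N) (j : ℕ) (B : Finset (TPt d (L ^ (N - j) * n))) :
    Finset (TPt d (L ^ (N - j) * n)) :=
  enl (5 * t j) B ∪ enl (5 * t j) (slot h j 0)

/-- `Λ^c_j` from `B = (Λ̄_{j−1})^c` and the level-`j` regions (see `omegaC`). [cite: Dimock2013BalabanIII, §3.2 eq. (understood) (arXiv:1304.0705v1 TeX L1654–1662)] -/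
def lambdaStep (t : ℕ → ℕ) (h : Hist d L n N) (j : ℕ) (B : Finset (TPt d (L ^ (N - j) * n))) :
    Finset (TPt d (L ^ (N - j) * n)) :=
  enl (5 * t j) (omegaC t h j B) ∪ enl (5 * t j) (slot h j 1) ∪ enl (5 * t j) (slot h j 2)

/-- **THE LARGE-FIELD REGIONS `Λ^c_j`, `j = 0, 1, …, 𝖭+1`, OF A HISTORY** — the recursion (understood) ([Dimock2013BalabanIII]
TeX L1654–1660, quoted at `omegaC`) run from `j = −1` with `Λ_{−1} =` the whole torus (so `Λ^c_0 = P_0^{10*} ∪ Q_0^{5*} ∪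
R_0^{5*}`, which is the print's *"We have Λ_0^c = Q_0^{5*}"* (TeX L2195) under the print's convention *"P₀, R₀, Q_{𝖭+1},
P_{𝖭+1} = ∅"* (TeX L1652) — the four slots are free here, as in `HistorySum`), with `[r_j]` layers given by the
schedule `t` (print: `t j = [r_j] = ⌊(−log λ_j)^r⌋`, II TeX L1652–1655 / III footnote TeX L428, see `lay`), the step
`j → j+1` coarsening by `Lstep_j` (`L`, or `1` at the last step) and `(Λ̄_j)^c` = the blocks inside `Λ^c_j` (`cinside`).
[cite: Dimock2013BalabanIII, §3.2 eq. (understood) (arXiv:1304.0705v1 TeX L1651–1662)] -/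
def lamC (t : ℕ → ℕ) (h : Hist d L n N) : (j : ℕ) → Finset (TPt d (L ^ (N - j) * n))
  | 0 => lambdaStep t h 0 ∅
  | j + 1 => lambdaStep t h (j + 1) (cinside (Lstep L N j) (L ^ (N - (j + 1)) * n) (lamC t h j))

/-- `Ω^c_{j+1}` of a history (for the record; `lamC (j+1) = (Ω^c_{j+1})^{5*} ∪ Q^{5*}_{j+1} ∪ R^{5*}_{j+1}`). [cite: Dimock2013BalabanIII, §3.2 eq. (understood) (arXiv:1304.0705v1 TeX L1654–1662)] -/
def omC (t : ℕ → ℕ) (h : Hist d L n N) (j : ℕ) : Finset (TPt d (L ^ (N - (j + 1)) * n)) :=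
  omegaC t h (j + 1) (cinside (Lstep L N j) (L ^ (N - (j + 1)) * n) (lamC t h j))

/-- The step of (understood), unfolded. [folklore] -/
theorem lamC_succ (t : ℕ → ℕ) (h : Hist d L n N) (j : ℕ) :
    lamC t h (j + 1) = enl (5 * t (j + 1)) (omC t h j) ∪ enl (5 * t (j + 1)) (slot h (j + 1) 1) ∪
      enl (5 * t (j + 1)) (slot h (j + 1) 2) := rfl

/-! ### The covering (claim): centres pushed forward along the tower, radii by the printed recursion -/

/-- THE CENTRES OF ORIGIN LEVEL `i` SEEN AT LEVEL `k`: the cubes of `𝒞_i`, mapped forward by the block maps of the steps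
`i → i+1 → … → k` (empty for `k < i`). [cite: Dimock2013BalabanIII, §3.5 proof of Lemma 14 (arXiv:1304.0705v1 TeX L2181–2226)] -/
def ctr (h : Hist d L n N) (i : ℕ) : (k : ℕ) → Finset (TPt d (L ^ (N - k) * n))
  | 0 => if i = 0 then cubes h 0 else ∅
  | k + 1 => if i = k + 1 then cubes h (k + 1) else (ctr h i k).image (cz L n N k)

/-- THE RADII (in cubes of level `k`) of the covering cubes of origin level `i`: `10[r_i]` at birth (`P_i^{10*}`,
`Q_i^{5*}`, `R_i^{5*}`), then per step: divide by the scale factor (integer part), add `1` for re-alignment to the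
coarse blocks, add `10[r_{k+1}]` for the two enlargements `((Λ̄_k)^{c,5*})^{5*}` — [Dimock2013BalabanIII] TeX
L2207–2209, verbatim: *"Each cube in this covering is enlarged to a cube which is a union of standard LM cubes (adding
less than 2LM to the width) and then further enlarged with by adding 10[r_{k+1}] layers of LM cubes. The overall
enlargement is less than 22LM[r_{k+1}]."* (print's widths `M(L^{−(k−i)}(1+22[r_i]) + 22 Σ L^{−(k−l)}[r_l])`; here
radii, with the print's `22` replaced by the exact bookkeeping `10·[r] (+1)`). [cite: Dimock2013BalabanIII, §3.5 proof of Lemma 14 eq. (claim) (arXiv:1304.0705v1 TeX L2181–2226)] -/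
def rad (L N : ℕ) (t : ℕ → ℕ) (i : ℕ) : (k : ℕ) → ℕ
  | 0 => 10 * t 0
  | k + 1 => if i = k + 1 then 10 * t (k + 1) else rad L N t i k / Lstep L N k + 1 + 10 * t (k + 1)

/-- The covering family of level `k`. [cite: Dimock2013BalabanIII, §3.5 proof of Lemma 14 eq. (claim) (arXiv:1304.0705v1 TeX L2181–2190)] -/
def cover (t : ℕ → ℕ) (h : Hist d L n N) (k : ℕ) : Finset (TPt d (L ^ (N - k) * n)) :=
  ucover k (fun i => ctr h i k) (fun i => rad L N t i k)

/-- At birth the centres are the cubes of `𝒞_k`. [folklore] -/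
theorem ctr_self (h : Hist d L n N) (k : ℕ) : ctr h k k = cubes h k := by
  cases k
  · exact if_pos rfl
  · exact if_pos rfl

/-- Later the centres are pushed forward by the block map. [folklore] -/
theorem ctr_succ_of_le (h : Hist d L n N) {i k : ℕ} (hik : i ≤ k) :
    ctr h i (k + 1) = (ctr h i k).image (cz L n N k) := by
  show (if i = k + 1 then cubes h (k + 1) else (ctr h i k).image (cz L n N k)) = _
  rw [if_neg (by omega)]

omit [NeZero L] in
/-- At birth the radius is `10[r_k]`. [folklore] -/
theorem rad_self (t : ℕ → ℕ) (k : ℕ) : rad L N t k k = 10 * t k := by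
  cases k
  · rfl
  · exact if_pos rfl

omit [NeZero L] in
/-- The radius recursion, unfolded. [folklore] -/
theorem rad_succ_of_le (t : ℕ → ℕ) {i k : ℕ} (hik : i ≤ k) :
    rad L N t i (k + 1) = rad L N t i k / Lstep L N k + 1 + 10 * t (k + 1) := by
  show (if i = k + 1 then 10 * t (k + 1) else rad L N t i k / Lstep L N k + 1 + 10 * t (k + 1)) = _
  rw [if_neg (by omega)]

/-- The number of centres of origin `i` never exceeds `|𝒞_i|` (block maps do not create cubes). [folklore] -/
theorem card_ctr_le (h : Hist d L n N) (i : ℕ) : ∀ k, (ctr h i k).card ≤ (cubes h i).card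
  | 0 => by
    show (if i = 0 then cubes h 0 else ∅).card ≤ _
    split
    · subst_vars; exact le_rfl
    · simp
  | k + 1 => by
    classical
    show (if i = k + 1 then cubes h (k + 1) else (ctr h i k).image (cz L n N k)).card ≤ _
    split
    · subst_vars; exact le_rfl
    · exact card_image_le.trans (card_ctr_le h i k)

/-- The birth of level `k`: `P_k^{10*} ∪ Q_k^{5*} ∪ R_k^{5*}`-type sets lie in the balls of radius `10[r_k]` around `𝒞_k`. [folklore] -/
theorem lambdaStep_new_subset (t : ℕ → ℕ) (h : Hist d L n N) (k : ℕ) (B : Finset (TPt d (L ^ (N - k) * n))) :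
    lambdaStep t h k B ⊆ enl (5 * t k) (enl (5 * t k) B) ∪ (cubes h k).biUnion fun c => tball c (10 * t k) := by
  intro y hy
  have e10 : 5 * t k + 5 * t k = 10 * t k := by ring
  simp only [lambdaStep, omegaC, enl_union, mem_union] at hy
  rcases hy with ((hB | hP) | hQ) | hR
  · exact mem_union_left _ hB
  · refine mem_union_right _ ?_
    have := enl_enl_subset (5 * t k) (5 * t k) (slot h k 0) hP
    rw [e10, enl_eq_biUnion] at this
    exact Finset.biUnion_subset_biUnion_of_subset_left _ (slot_subset_cubes h k 0) this
  · refine mem_union_right _ ?_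
    have := (enl_mono (s := 5 * t k) (slot_subset_cubes h k 1)) hQ
    rw [enl_eq_biUnion] at this
    exact (Finset.biUnion_mono fun c _ => tball_mono (by omega)) this
  · refine mem_union_right _ ?_
    have := (enl_mono (s := 5 * t k) (slot_subset_cubes h k 2)) hR
    rw [enl_eq_biUnion] at this
    exact (Finset.biUnion_mono fun c _ => tball_mono (by omega)) this

/-- **THE COVERING (claim)** — [Dimock2013BalabanIII] TeX L2181–2190, verbatim: *"We first claim that Λ_k^c can be covered
by all of the following: |𝒞₀| cubes of width ≤ M(L^{−k}(1+22[r₀]) + 22L^{−(k−1)}[r₁] + … + 22L^{−1}[r_{k−1}] + 22[r_k]),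
|𝒞₁| cubes of width ≤ M(L^{−(k−1)}(1+22[r₁]) + … + 22[r_k]), …, |𝒞_k| cubes of width ≤ M(1 + 22[r_k])"*, proved as in
print (TeX L2194–2226) *"The proof is by induction on k … The covering of Λ^c_k is also a covering of the smaller set
Λ̄_k^c. Each cube in this covering is enlarged … Thus we have a covering of (Λ̄^c_k)^{10*} by"* [the family (claim2)]
*"In addition if 𝒞_{k+1} is the LM cubes in P_{k+1} ∪ Q_{k+1} ∪ R_{k+1} we can cover P_{k+1}^{10*} ∪ Q_{k+1}^{5*} ∪
R_{k+1}^{5*} by |𝒞_{k+1}| cubes of width ≤ LM(1 + 22[r_{k+1}])"*: here with sup-norm balls of the radii `rad` around the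
forwarded centres `ctr`. [cite: Dimock2013BalabanIII, §3.5 proof of Lemma 14 eq. (claim) (arXiv:1304.0705v1 TeX L2181–2226)] -/
theorem lamC_subset_cover (t : ℕ → ℕ) (h : Hist d L n N) : ∀ k, lamC t h k ⊆ cover t h k
  | 0 => by
    intro y hy
    have hy' := lambdaStep_new_subset t h 0 ∅ hy
    have he : enl (5 * t 0) (enl (5 * t 0) (∅ : Finset (TPt d (L ^ (N - 0) * n)))) = ∅ := by simp [enl]
    rw [he, empty_union] at hy'
    unfold cover
    refine biUnion_subset_ucover 0 _ _ ?_
    rw [ctr_self, rad_self]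
    exact hy'
  | k + 1 => by
    classical
    intro y hy
    have ih := lamC_subset_cover t h k
    have hmod := tower_mod L n N k
    set B := cinside (Lstep L N k) (L ^ (N - (k + 1)) * n) (lamC t h k) with hBdef
    have hy' := lambdaStep_new_subset t h (k + 1) B hy
    unfold cover
    rcases mem_union.1 hy' with hold | hnew
    · -- the old part: `((Λ̄_k)^{c})^{10*}`
      have hB : B ⊆ ucover k (fun i => ctr h i (k + 1)) (fun i => rad L N t i k / Lstep L N k + 1) := by
        calc B ⊆ (lamC t h k).image (cz L n N k) := cinside_subset_image hmod _
          _ ⊆ (cover t h k).image (cz L n N k) := image_subset_image ih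
          _ ⊆ ucover k (fun i => (ctr h i k).image (cz L n N k)) (fun i => rad L N t i k / Lstep L N k + 1) :=
              image_ucover_subset hmod k _ _
          _ ⊆ ucover k (fun i => ctr h i (k + 1)) (fun i => rad L N t i k / Lstep L N k + 1) :=
              ucover_mono (fun i hi => by rw [ctr_succ_of_le h hi]) (fun i _ => le_rfl)
      have h2 : enl (5 * t (k + 1)) (enl (5 * t (k + 1)) B) ⊆
          ucover k (fun i => ctr h i (k + 1)) (fun i => rad L N t i (k + 1)) :=
        calc enl (5 * t (k + 1)) (enl (5 * t (k + 1)) B)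
            ⊆ enl (5 * t (k + 1) + 5 * t (k + 1)) B := enl_enl_subset _ _ _
          _ ⊆ ucover k (fun i => ctr h i (k + 1))
                (fun i => rad L N t i k / Lstep L N k + 1 + (5 * t (k + 1) + 5 * t (k + 1))) :=
              (enl_mono hB).trans (enl_ucover_subset _ k _ _)
          _ ⊆ ucover k (fun i => ctr h i (k + 1)) (fun i => rad L N t i (k + 1)) :=
              ucover_mono (fun i _ => le_rfl) fun i hi => by
                rw [rad_succ_of_le t hi]; omega
      exact ucover_subset_succ k _ _ (h2 hold)
    · refine biUnion_subset_ucover (k + 1) _ _ ?_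
      rw [ctr_self, rad_self]
      exact hnew

/-- **THE VOLUME OF `Λ_k^c` IN CUBES**: `#Λ_k^c ≤ Σ_{i≤k} |𝒞_i| (2·rad_{i,k} + 1)^d`. [cite: Dimock2013BalabanIII, §3.5 proof of Lemma 14 (arXiv:1304.0705v1 TeX L2229–2238)] -/
theorem card_lamC_le (t : ℕ → ℕ) (h : Hist d L n N) (k : ℕ) :
    (lamC t h k).card ≤ ∑ i ∈ range (k + 1), (cubes h i).card * (2 * rad L N t i k + 1) ^ d :=
  calc (lamC t h k).card ≤ (cover t h k).card := card_le_card (lamC_subset_cover t h k)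
    _ ≤ ∑ i ∈ range (k + 1), (ctr h i k).card * (2 * rad L N t i k + 1) ^ d := card_ucover_le k _ _
    _ ≤ ∑ i ∈ range (k + 1), (cubes h i).card * (2 * rad L N t i k + 1) ^ d :=
        sum_le_sum fun i _ => Nat.mul_le_mul_right _ (card_ctr_le h i k)

end Regions

/-! ## Part 7. The tacit nesting `Λ^c_j ⊆ Λ^c_{j+1}` behind *"contained in Θ"* (TeX L2310), with its conditions explicit -/

section Nesting

variable {d L n N : ℕ} [NeZero L] [NeZero n]

/-- Every point of a region built by `lambdaStep` sits in a whole ball of radius `5[r_j]` inside it. [folklore] -/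
theorem exists_tball_of_mem_lambdaStep (t : ℕ → ℕ) (h : Hist d L n N) (j : ℕ)
    (B : Finset (TPt d (L ^ (N - j) * n))) {x : TPt d (L ^ (N - j) * n)} (hx : x ∈ lambdaStep t h j B) :
    ∃ y, x ∈ tball y (5 * t j) ∧ tball y (5 * t j) ⊆ lambdaStep t h j B := by
  have key : ∀ (Y : Finset (TPt d (L ^ (N - j) * n))), enl (5 * t j) Y ⊆ lambdaStep t h j B →
      x ∈ enl (5 * t j) Y → ∃ y, x ∈ tball y (5 * t j) ∧ tball y (5 * t j) ⊆ lambdaStep t h j B := by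
    intro Y hY hxY
    obtain ⟨y, hy, hxy⟩ := mem_enl.1 hxY
    exact ⟨y, hxy, (Finset.subset_biUnion_of_mem (fun c => tball c (5 * t j)) hy).trans hY⟩
  unfold lambdaStep at hx ⊢
  rcases mem_union.1 hx with hx | hx
  · rcases mem_union.1 hx with hx | hx
    · exact key _ (subset_union_left.trans subset_union_left) hx
    · exact key _ (subset_union_right.trans subset_union_left) hx
  · exact key _ subset_union_right hx

/-- `Λ^c_j` is a `lambdaStep`. [folklore] -/
theorem lamC_eq_lambdaStep (t : ℕ → ℕ) (h : Hist d L n N) (j : ℕ) : ∃ B, lamC t h j = lambdaStep t h j B := by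
  cases j
  · exact ⟨∅, rfl⟩
  · exact ⟨_, rfl⟩

/-- THE REGIONS OF LEVEL `j` LIE IN `Λ^c_j`: `P_j, Q_j, R_j ⊆ Λ^c_j` (from (understood): `P^{5*}_j ⊆ Ω^c_j`,
`(Ω^c_j)^{5*} ∪ Q^{5*}_j ∪ R^{5*}_j = Λ^c_j`). [cite: Dimock2013BalabanIII, §3.2 eq. (understood) (arXiv:1304.0705v1 TeX L1654–1662)] -/
theorem slot_subset_lamC (t : ℕ → ℕ) (h : Hist d L n N) (j : ℕ) (X : Fin 3) : slot h j X ⊆ lamC t h j := by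
  obtain ⟨B, hB⟩ := lamC_eq_lambdaStep t h j
  rw [hB]
  intro x hx
  unfold lambdaStep omegaC
  fin_cases X
  · exact mem_union_left _ (mem_union_left _ (subset_enl _ _
      (mem_union_right _ (subset_enl _ _ hx))))
  · exact mem_union_left _ (mem_union_right _ (subset_enl _ _ hx))
  · exact mem_union_right _ (subset_enl _ _ hx)

/-- A block all of whose cubes lie inside a ball inside `Λ^c_j` is a block of `(Λ̄_j)^c`. [folklore] -/
theorem cz_mem_cinside_of_tball_subset (t : ℕ → ℕ) (h : Hist d L n N) (j : ℕ) {y : TPt d (L ^ (N - j) * n)} {ρ : ℕ}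
    (hρ : Lstep L N j - 1 ≤ ρ) (hy : tball y ρ ⊆ lamC t h j) :
    cz L n N j y ∈ cinside (Lstep L N j) (L ^ (N - (j + 1)) * n) (lamC t h j) := by
  refine mem_cinside.2 fun a ha => hy (tball_mono hρ ?_)
  exact mem_tball_of_czmap_eq (tower_mod L n N j) ha

/-- A block of `(Λ̄_j)^c` has its whole `5[r_{j+1}]`-ball inside `Λ^c_{j+1}`. [folklore] -/
theorem tball_subset_lamC_succ (t : ℕ → ℕ) (h : Hist d L n N) (j : ℕ) {z : TPt d (L ^ (N - (j + 1)) * n)}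
    (hz : z ∈ cinside (Lstep L N j) (L ^ (N - (j + 1)) * n) (lamC t h j)) :
    tball z (5 * t (j + 1)) ⊆ lamC t h (j + 1) := by
  intro w hw
  rw [lamC_succ]
  refine mem_union_left _ (mem_union_left _ (subset_enl _ _ ?_))
  unfold omC omegaC
  exact mem_union_left _ (mem_enl.2 ⟨z, hz, hw⟩)

/-- **THE TACIT NESTING.**  [Dimock2013BalabanIII] TeX L2310 *"Now drop all conditions on P_j, Q_j, R_j except that they
are unions of L^{−(𝖭−j)}M cubes □ contained in Θ"* presupposes that the regions of every level lie inside `Θ =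
Λ^c_{𝖭+1}`, i.e. (with `slot_subset_lamC`) that consecutive large-field regions are NESTED through the block map,
`Λ^c_j ⊆ Λ^c_{j+1}`.  This is not automatic from (understood) — `(Λ̄_j)^c ⊆ Λ^c_j` DROPS the blocks only partly inside
`Λ^c_j` — but holds as soon as, at the rescaling steps `j < 𝖭`, (N1) `L − 1 ≤ 5[r_j]` (a ball of `Λ^c_j` contains the
whole block of its centre) and (N2) `⌊5[r_j]/L⌋ + 1 ≤ 5[r_{j+1}]` (the re-enlargement by `5[r_{j+1}]` blocks recovers the
dropped fringe); both hold for `λ` small at fixed `L, r` (`[r_j] ≥ L`; `r_j/r_{j+1} = (1 + log L/(−log λ_{j+1}))^r → 1`),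
and the last step `𝖭 → 𝖭+1` (no rescaling) needs nothing.  A Dimock-internal tacit step, recorded for the cell's T-G22
list; it concerns only the INDEX SET of (randall) (`regionHist`), not Lemma 14. [cite: Dimock2013BalabanIII, §3.5 proof of Lemma 15 (arXiv:1304.0705v1 TeX L2310)] -/
theorem image_lamC_subset_succ (t : ℕ → ℕ) (h : Hist d L n N) (j : ℕ)
    (hc : j < N → L - 1 ≤ 5 * t j ∧ 5 * t j / L + 1 ≤ 5 * t (j + 1)) :
    (lamC t h j).image (cz L n N j) ⊆ lamC t h (j + 1) := by
  classical
  intro b hb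
  obtain ⟨x, hx, rfl⟩ := mem_image.1 hb
  rcases Nat.lt_or_ge j N with hj | hj
  · -- a rescaling step: go through the centre `y` of a ball of `Λ^c_j` containing `x`
    obtain ⟨hc1, hc2⟩ := hc hj
    obtain ⟨B, hB⟩ := lamC_eq_lambdaStep t h j
    obtain ⟨y, hxy, hy⟩ := exists_tball_of_mem_lambdaStep t h j B (hB ▸ hx)
    rw [← hB] at hy
    have hL : Lstep L N j = L := Lstep_of_lt hj
    have hz := cz_mem_cinside_of_tball_subset t h j (ρ := 5 * t j) (by rw [hL]; exact hc1) hy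
    refine tball_subset_lamC_succ t h j hz (tball_mono ?_ (czmap_mem_tball (tower_mod L n N j) hxy))
    rw [hL]
    exact hc2
  · -- the last step(s): no rescaling, the block of `x` is `x`
    have hL : Lstep L N j = 1 := Lstep_of_le hj
    have hz := cz_mem_cinside_of_tball_subset t h j (y := x) (ρ := 0) (by rw [hL])
      (fun a ha => by rw [eq_of_mem_tball_zero ha]; exact hx)
    exact tball_subset_lamC_succ t h j hz (self_mem_tball _ _)

end Nesting

/-! ## Part 5. The arithmetic of the radii: `rad_{i,k} ≤ G(r)·r_k` with an absolute `G(r)` (TeX L2239–2249) -/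

section Arithmetic

/-- A finite geometric sum is below the full series. [folklore] -/
theorem geom_sum_le_inv {q : ℝ} (hq0 : 0 ≤ q) (hq1 : q < 1) (m : ℕ) :
    ∑ e ∈ range m, q ^ e ≤ (1 - q)⁻¹ := by
  rw [← tsum_geometric_of_lt_one hq0 hq1]
  exact (summable_geometric_of_lt_one hq0 hq1).sum_le_tsum (range m) fun i _ => pow_nonneg hq0 i

/-- `u^r ≤ 2^r · r! · e^{u/2}` for `u ≥ 0` (exponential series). [folklore] -/
theorem pow_le_two_pow_factorial_exp_half {u : ℝ} (hu : 0 ≤ u) (r : ℕ) :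
    u ^ r ≤ 2 ^ r * r.factorial * Real.exp (u / 2) := by
  have h := Real.pow_div_factorial_le_exp (x := u / 2) (by linarith) r
  have hf : (0 : ℝ) < r.factorial := by exact_mod_cast Nat.factorial_pos r
  rw [div_le_iff₀ hf, div_pow] at h
  have h2 : (0 : ℝ) < 2 ^ r := by positivity
  rw [div_le_iff₀ h2] at h
  calc u ^ r ≤ Real.exp (u / 2) * r.factorial * 2 ^ r := h
    _ = 2 ^ r * r.factorial * Real.exp (u / 2) := by ring

/-- THE TERMWISE BOUND behind *"Σ_j L^{−j}(1 + j log L)[^r] ≤ 𝒪(1)"* (TeX L2243–2247): for `log L ≥ 1`,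
`(1 + e·log L)^r · L^{−e} ≤ 4^r · r! · (2/3)^e`. [cite: Dimock2013BalabanIII, §3.5 proof of Lemma 14 (arXiv:1304.0705v1 TeX L2239–2249)] -/
theorem term_le {x : ℝ} (hx : 1 ≤ x) (r e : ℕ) :
    (1 + e * x) ^ r * Real.exp (-(e * x)) ≤ 4 ^ r * r.factorial * (2 / 3 : ℝ) ^ e := by
  have hf : (1 : ℝ) ≤ r.factorial := by exact_mod_cast Nat.succ_le_of_lt (Nat.factorial_pos r)
  rcases Nat.eq_zero_or_pos e with rfl | he
  · simp only [Nat.cast_zero, zero_mul, add_zero, one_pow, neg_zero, Real.exp_zero, mul_one, pow_zero]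
    calc (1 : ℝ) = 1 * 1 := by ring
      _ ≤ 4 ^ r * r.factorial := mul_le_mul (one_le_pow₀ (by norm_num)) hf (by norm_num) (by positivity)
  · have he1 : (1 : ℝ) ≤ e := by exact_mod_cast he
    set u : ℝ := e * x with hu
    have hu1 : (e : ℝ) ≤ u := by rw [hu]; nlinarith
    have hu0 : 0 ≤ u := by linarith
    -- (1+u)^r ≤ (2u)^r = 2^r u^r ≤ 2^r · 2^r r! e^{u/2}
    have h1 : (1 + u) ^ r ≤ (2 * u) ^ r := pow_le_pow_left₀ (by linarith) (by linarith) r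
    have h2 : (2 * u) ^ r ≤ 4 ^ r * r.factorial * Real.exp (u / 2) := by
      rw [mul_pow]
      calc (2 : ℝ) ^ r * u ^ r ≤ 2 ^ r * (2 ^ r * r.factorial * Real.exp (u / 2)) :=
            mul_le_mul_of_nonneg_left (pow_le_two_pow_factorial_exp_half hu0 r) (by positivity)
        _ = 4 ^ r * r.factorial * Real.exp (u / 2) := by
            rw [show (4 : ℝ) ^ r = 2 ^ r * 2 ^ r by rw [← mul_pow]; norm_num]; ring
    -- e^{u/2} e^{−u} = e^{−u/2} ≤ e^{−e/2} = (e^{−1/2})^e ≤ (2/3)^e  (e^{−1/2} ≤ 2/3 from 1 + x ≤ e^x; the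
    -- numerical fact is also `MatomakiMerikoski.exp_neg_one_half_le_two_thirds` of an unrelated Literature module,
    -- re-derived inline here rather than imported across topics)
    have hexp : Real.exp (-(1 / 2 : ℝ)) ≤ 2 / 3 := by
      have h : (3 / 2 : ℝ) ≤ Real.exp (1 / 2) := by
        have := Real.add_one_le_exp (1 / 2 : ℝ)
        linarith
      rw [Real.exp_neg]
      calc (Real.exp (1 / 2))⁻¹ ≤ (3 / 2 : ℝ)⁻¹ := inv_anti₀ (by norm_num) h
        _ = 2 / 3 := by norm_num
    have h3 : Real.exp (u / 2) * Real.exp (-u) ≤ (2 / 3 : ℝ) ^ e := by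
      rw [← Real.exp_add, show u / 2 + -u = -(u / 2) by ring]
      calc Real.exp (-(u / 2)) ≤ Real.exp (-((e : ℝ) / 2)) := Real.exp_le_exp.2 (by linarith)
        _ = Real.exp (-(1 / 2 : ℝ)) ^ e := by rw [← Real.exp_nat_mul]; congr 1; ring
        _ ≤ (2 / 3 : ℝ) ^ e := pow_le_pow_left₀ (Real.exp_pos _).le hexp e
    calc (1 + u) ^ r * Real.exp (-u) ≤ 4 ^ r * r.factorial * Real.exp (u / 2) * Real.exp (-u) :=
          mul_le_mul_of_nonneg_right (h1.trans h2) (Real.exp_pos _).le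
      _ = 4 ^ r * r.factorial * (Real.exp (u / 2) * Real.exp (-u)) := by ring
      _ ≤ 4 ^ r * r.factorial * (2 / 3 : ℝ) ^ e := mul_le_mul_of_nonneg_left h3 (by positivity)

/-- **THE SERIES BOUND** replacing the print's *"[Σ_{j=0}^k L^{−j}(1 + j log L)]³ ≤ 𝒪(1)"* (TeX L2243–2247; the print
drops the exponent `r` of `(1 + j log L)^r` coming from `r_{k−j} ≤ (1 + j log L)^r r_k`, TeX L2241): for `log L ≥ 1`
and every `m`, `Σ_{e<m} (1 + e log L)^r e^{−e log L} ≤ 3 · 4^r · r!` — an ABSOLUTE constant given the fixed exponent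
`r`. [cite: Dimock2013BalabanIII, §3.5 proof of Lemma 14 (arXiv:1304.0705v1 TeX L2239–2249)] -/
theorem series_le {x : ℝ} (hx : 1 ≤ x) (r m : ℕ) :
    ∑ e ∈ range m, (1 + e * x) ^ r * Real.exp (-(e * x)) ≤ 3 * 4 ^ r * r.factorial := by
  calc ∑ e ∈ range m, (1 + e * x) ^ r * Real.exp (-(e * x))
      ≤ ∑ e ∈ range m, 4 ^ r * r.factorial * (2 / 3 : ℝ) ^ e := sum_le_sum fun e _ => term_le hx r e
    _ = 4 ^ r * r.factorial * ∑ e ∈ range m, (2 / 3 : ℝ) ^ e := by rw [mul_sum]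
    _ ≤ 4 ^ r * r.factorial * 3 := by
        refine mul_le_mul_of_nonneg_left ?_ (by positivity)
        have := geom_sum_le_inv (q := (2 / 3 : ℝ)) (by norm_num) (by norm_num) m
        norm_num at this ⊢
        exact this
    _ = 3 * 4 ^ r * r.factorial := by ring

/-- THE CONSTANT OF THE RADIUS BOUND up to level `𝖭`: `S(r) = 30 · 4^r · r! + 3/2`. [folklore] -/
def Sr (r : ℕ) : ℝ := 30 * 4 ^ r * r.factorial + 3 / 2

/-- THE CONSTANT OF THE RADIUS BOUND for all levels `≤ 𝖭+1`: `G(r) = S(r) + 11`. [folklore] -/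
def Gr (r : ℕ) : ℝ := Sr r + 11

/-- **THE `𝒪(1)` OF LEMMA 14, EXPLICIT**: `A(r) = (2 G(r) + 1)³`, `G(r) = 30·4^r·r! + 25/2` — depends only on the
fixed exponent `r` of `r_k = (−log λ_k)^r` ([Dimock2013BalabanII] TeX L1655 *"some postive [sic] integer r"*); valid
for `log L ≥ 1` and `−log λ ≥ 1` (`card_lamC_le_ell`). [cite: Dimock2013BalabanIII, §3.5 Lemma 14 eq. (ugh2) (arXiv:1304.0705v1 TeX L2173–2177)] -/
def A14 (r : ℕ) : ℝ := (2 * Gr r + 1) ^ 3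

/-- `S(r) > 0`. [folklore] -/
theorem Sr_pos (r : ℕ) : 0 < Sr r := by unfold Sr; positivity

/-- `S(r) ≥ 1`. [folklore] -/
theorem one_le_Sr (r : ℕ) : 1 ≤ Sr r := by
  unfold Sr
  have : (0 : ℝ) ≤ 30 * 4 ^ r * r.factorial := by positivity
  linarith

/-- `S(r) ≤ G(r)`. [folklore] -/
theorem Sr_le_Gr (r : ℕ) : Sr r ≤ Gr r := by unfold Gr; linarith

/-- `G(r) > 0`. [folklore] -/
theorem Gr_pos (r : ℕ) : 0 < Gr r := by unfold Gr; linarith [Sr_pos r]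

/-- `A14 r > 0` (as `HistorySum.LargeLog.A_pos` wants). [folklore] -/
theorem A14_pos (r : ℕ) : 0 < A14 r := by unfold A14; have := Gr_pos r; positivity

end Arithmetic

section RadiusBound

variable {d L n N : ℕ} [NeZero L] [NeZero n]

/-- `−log λ_j = (𝖭−j) log L − log λ` on the levels `j = 0, 1, …` (`= −log λ` from `j = 𝖭` on; `HistorySum.ell` on `Fin
(𝖭+2)`): [Dimock2013BalabanIII] TeX L267 *"λ_k = L^{−(𝖭−k)}λ"*. [cite: Dimock2013BalabanIII, Theorem 1 (arXiv:1304.0705v1 TeX L267)] -/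
def ellN (L : ℕ) (lam : ℝ) (N j : ℕ) : ℝ := ((N - j : ℕ) : ℝ) * Real.log L - Real.log lam

/-- `ellN` restricted to `Fin (𝖭+2)` is `HistorySum.ell`. [folklore] -/
theorem ellN_fin (L : ℕ) (lam : ℝ) (N : ℕ) (j : Fin (N + 2)) : ellN L lam N j.val = ell L lam N j := rfl

/-- `[r_j] = ⌊(−log λ_j)^r⌋` — [Dimock2013BalabanIII] footnote TeX L428–429, verbatim: *"Let r_k = (−log λ_k)^r. Recall
that for a union of M cubes X in 𝕋^{−k}_𝖬, X^* is an enlargement by [r_k] layers of M cubes"*; [Dimock2013BalabanII]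
TeX L1653–1655 *"r_k = (−log λ_k)^r"* for *"some postive [sic] integer r"*. [cite: Dimock2013BalabanIII, §2 footnote (arXiv:1304.0705v1 TeX L428–429)] -/
def lay (L : ℕ) (lam : ℝ) (N r j : ℕ) : ℕ := ⌊ellN L lam N j ^ r⌋₊

/-- The standing largeness of this module: `log L ≥ 1` (TeX L2272 uses *"N − i ≤ (N−i) log L"*, cf.
`HistorySum.LargeLog.logL`) and `−log λ ≥ 1` (TeX L2241 *"r_{k−j} ≤ (1 + j log L)^r r_k"* needs `−log λ_k ≥ 1`;
`HistorySum.LargeLog.ell₀` has `−log λ ≥ 2`). [cite: Dimock2013BalabanIII, §3.5 proof of Lemma 14 (arXiv:1304.0705v1 TeX L2239–2249)] -/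
structure Large (L : ℕ) (lam : ℝ) : Prop where
  logL : 1 ≤ Real.log L
  ell₀ : 1 ≤ -Real.log lam

variable {lam : ℝ} {r : ℕ}

omit [NeZero n] in
/-- `L > 0` as a real. [folklore] -/
theorem cast_L_pos : (0 : ℝ) < L := by exact_mod_cast Nat.pos_of_ne_zero (NeZero.ne L)

omit [NeZero n] in
/-- `L^{−e} = e^{−e log L}`. [folklore] -/
theorem inv_pow_eq_exp (e : ℕ) : (1 / (L : ℝ)) ^ e = Real.exp (-(e * Real.log L)) := by
  rw [show -((e : ℝ) * Real.log L) = e * (-Real.log L) by ring, Real.exp_nat_mul, Real.exp_neg,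
    Real.exp_log cast_L_pos, one_div]


omit [NeZero n] in
/-- `L ≥ 3` from `log L ≥ 1`. [folklore] -/
theorem Large.three_le_L (hp : Large L lam) : 3 ≤ L := by
  by_contra hlt
  have hL : L ≤ 2 := by omega
  have h1 : Real.log L ≤ Real.log 2 :=
    Real.log_le_log cast_L_pos (by exact_mod_cast hL)
  linarith [hp.logL, Real.log_two_lt_d9]

omit [NeZero n] in
/-- `Σ_{e<m} L^{−e} ≤ 3/2` for `L ≥ 3`. [folklore] -/
theorem Large.geom_le (hp : Large L lam) (m : ℕ) : ∑ e ∈ range m, (1 / (L : ℝ)) ^ e ≤ 3 / 2 := by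
  have h3 : (3 : ℝ) ≤ L := by exact_mod_cast hp.three_le_L
  have hq0 : (0 : ℝ) ≤ 1 / L := by positivity
  have hq : 1 / (L : ℝ) ≤ 1 / 3 := one_div_le_one_div_of_le (by norm_num) h3
  have hq1 : 1 / (L : ℝ) < 1 := by linarith
  refine (geom_sum_le_inv hq0 hq1 m).trans ?_
  rw [inv_le_comm₀ (by linarith) (by norm_num)]
  linarith

omit [NeZero L] [NeZero n] in
/-- `−log λ_k ≥ 1` at every level. [folklore] -/
theorem Large.one_le_ellN (hp : Large L lam) (N k : ℕ) : 1 ≤ ellN L lam N k := by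
  unfold ellN
  have : (0 : ℝ) ≤ ((N - k : ℕ) : ℝ) * Real.log L := mul_nonneg (Nat.cast_nonneg _) (by linarith [hp.logL])
  linarith [hp.ell₀]

omit [NeZero L] [NeZero n] in
/-- `−log λ_k > 0`. [folklore] -/
theorem Large.ellN_pos (hp : Large L lam) (N k : ℕ) : 0 < ellN L lam N k := by linarith [hp.one_le_ellN N k]

omit [NeZero L] [NeZero n] in
/-- `r_k ≥ 1`. [folklore] -/
theorem Large.one_le_ellN_pow (hp : Large L lam) (N k r : ℕ) : 1 ≤ ellN L lam N k ^ r :=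
  one_le_pow₀ (hp.one_le_ellN N k)

omit [NeZero L] [NeZero n] in
/-- `[r_k] ≤ r_k`. [folklore] -/
theorem Large.lay_le (hp : Large L lam) (N r k : ℕ) : (lay L lam N r k : ℝ) ≤ ellN L lam N k ^ r :=
  Nat.floor_le (pow_nonneg (hp.ellN_pos N k).le r)

omit [NeZero L] [NeZero n] in
/-- `−log λ_{k−e} = −log λ_k + e log L` for `e ≤ k ≤ 𝖭`. [folklore] -/
theorem ellN_sub (lam : ℝ) {N k e : ℕ} (hk : k ≤ N) (he : e ≤ k) :
    ellN L lam N (k - e) = ellN L lam N k + e * Real.log L := by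
  unfold ellN
  have : (N - (k - e) : ℕ) = (N - k) + e := by omega
  rw [this, Nat.cast_add]
  ring

omit [NeZero L] [NeZero n] in
/-- `−log λ_{𝖭+1} = −log λ_𝖭 = −log λ` (the last step has the parameters of level `𝖭`, `HistorySum` reading (iii)). [folklore] -/
theorem ellN_last (lam : ℝ) (N : ℕ) : ellN L lam N (N + 1) = ellN L lam N N := by
  unfold ellN
  rw [Nat.sub_self, show N - (N + 1) = 0 by omega]

omit [NeZero L] [NeZero n] in
/-- *"r_{k−j} ≤ (1 + j log L)^r r_k"* (TeX L2241; uses `−log λ_k ≥ 1`), for the integer parts: `[r_{k−e}] ≤ (1 + e log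
L)^r r_k`. [cite: Dimock2013BalabanIII, §3.5 proof of Lemma 14 (arXiv:1304.0705v1 TeX L2239–2242)] -/
theorem Large.lay_sub_le (hp : Large L lam) (r : ℕ) {N k e : ℕ} (hk : k ≤ N) (he : e ≤ k) :
    (lay L lam N r (k - e) : ℝ) ≤ (1 + e * Real.log L) ^ r * ellN L lam N k ^ r := by
  refine (hp.lay_le N r (k - e)).trans ?_
  rw [ellN_sub lam hk he, ← mul_pow]
  have h1 := hp.one_le_ellN N k
  have h2 : (0 : ℝ) ≤ e * Real.log L := mul_nonneg (Nat.cast_nonneg _) (by linarith [hp.logL])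
  refine pow_le_pow_left₀ (by linarith) ?_ r
  nlinarith

omit [NeZero n] in
/-- THE RADII UP TO LEVEL `𝖭`, UNROLLED: `rad_{i,k} ≤ Σ_{e=0}^{k−i} (10[r_{k−e}] + 1) L^{−e}` — the widths of (claim)
*"M(L^{−(k−i)}(1+22[r_i]) + 22L^{−(k−i−1)}[r_{i+1}] + … + 22[r_k])"* (TeX L2184–2188) in radius form. [cite: Dimock2013BalabanIII, §3.5 proof of Lemma 14 eq. (claim) (arXiv:1304.0705v1 TeX L2181–2190)] -/
theorem rad_le_sum (t : ℕ → ℕ) {i k : ℕ} (hik : i ≤ k) (hkN : k ≤ N) :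
    (rad L N t i k : ℝ) ≤ ∑ e ∈ range (k - i + 1), (10 * (t (k - e) : ℝ) + 1) * (1 / (L : ℝ)) ^ e := by
  induction k, hik using Nat.le_induction with
  | base =>
    rw [rad_self, Nat.sub_self, zero_add, sum_range_one, Nat.sub_zero, pow_zero, mul_one]
    push_cast
    linarith
  | succ k hik ih =>
    have hk : k ≤ N := Nat.le_of_succ_le hkN
    have hkN' : k < N := hkN
    have ih' := ih hk
    have hL : (0 : ℝ) < L := cast_L_pos
    rw [rad_succ_of_le t hik, Lstep_of_lt hkN']
    have hdiv : ((rad L N t i k / L : ℕ) : ℝ) ≤ (rad L N t i k : ℝ) / L := Nat.cast_div_le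
    have e1 : k + 1 - i + 1 = (k - i + 1) + 1 := by omega
    rw [e1, sum_range_succ']
    have e2 : ∀ e ∈ range (k - i + 1), (10 * (t (k + 1 - (e + 1)) : ℝ) + 1) * (1 / (L : ℝ)) ^ (e + 1)
        = (1 / (L : ℝ)) * ((10 * (t (k - e) : ℝ) + 1) * (1 / (L : ℝ)) ^ e) := by
      intro e _
      rw [show k + 1 - (e + 1) = k - e by omega, pow_succ]
      ring
    rw [sum_congr rfl e2, ← mul_sum, Nat.sub_zero, pow_zero, mul_one]
    push_cast
    have h3 : (rad L N t i k : ℝ) / L ≤ 1 / (L : ℝ) * ∑ e ∈ range (k - i + 1),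
        (10 * (t (k - e) : ℝ) + 1) * (1 / (L : ℝ)) ^ e := by
      rw [div_eq_mul_one_div, mul_comm]
      exact mul_le_mul_of_nonneg_left ih' (by positivity)
    linarith

omit [NeZero n] in
/-- THE RADII UP TO LEVEL `𝖭`: `rad_{i,k} ≤ S(r) · r_k` for `i ≤ k ≤ 𝖭` — TeX L2243–2249 *"So the first term is bounded by
M³ r_k³ [Σ_{j=0}^k L^{−j}(1 + j log L)]³|𝒞₀| ≤ 𝒪(1)M³r_k³|𝒞₀|. The other sums in the other terms are even smaller"*. [cite: Dimock2013BalabanIII, §3.5 proof of Lemma 14 (arXiv:1304.0705v1 TeX L2239–2249)] -/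
theorem rad_le_Sr (hp : Large L lam) (r : ℕ) {i k : ℕ} (hik : i ≤ k) (hkN : k ≤ N) :
    (rad L N (lay L lam N r) i k : ℝ) ≤ Sr r * ellN L lam N k ^ r := by
  set x := Real.log L with hx
  set ℓ := ellN L lam N k with hℓ
  have hℓ1 : 1 ≤ ℓ ^ r := hp.one_le_ellN_pow N k r
  have hℓ0 : 0 ≤ ℓ ^ r := by linarith
  refine (rad_le_sum (lay L lam N r) hik hkN).trans ?_
  -- termwise
  have hterm : ∀ e ∈ range (k - i + 1),
      (10 * (lay L lam N r (k - e) : ℝ) + 1) * (1 / (L : ℝ)) ^ e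
        ≤ 10 * ℓ ^ r * ((1 + e * x) ^ r * Real.exp (-(e * x))) + (1 / (L : ℝ)) ^ e := by
    intro e he
    have hek : e ≤ k := by have := mem_range.1 he; omega
    have h1 := hp.lay_sub_le r hkN hek
    have hq : (0 : ℝ) ≤ (1 / (L : ℝ)) ^ e := by positivity
    calc (10 * (lay L lam N r (k - e) : ℝ) + 1) * (1 / (L : ℝ)) ^ e
        ≤ (10 * ((1 + e * x) ^ r * ℓ ^ r) + 1) * (1 / (L : ℝ)) ^ e :=
          mul_le_mul_of_nonneg_right (by linarith) hq
      _ = 10 * ℓ ^ r * ((1 + e * x) ^ r * Real.exp (-(e * x))) + (1 / (L : ℝ)) ^ e := by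
          rw [inv_pow_eq_exp]; ring
  refine (sum_le_sum hterm).trans ?_
  rw [sum_add_distrib, ← mul_sum]
  have hS := series_le hp.logL r (k - i + 1)
  have hG := hp.geom_le (k - i + 1)
  calc 10 * ℓ ^ r * ∑ e ∈ range (k - i + 1), (1 + e * x) ^ r * Real.exp (-(e * x))
        + ∑ e ∈ range (k - i + 1), (1 / (L : ℝ)) ^ e
      ≤ 10 * ℓ ^ r * (3 * 4 ^ r * r.factorial) + 3 / 2 :=
        add_le_add (mul_le_mul_of_nonneg_left hS (by positivity)) hG
    _ ≤ 10 * ℓ ^ r * (3 * 4 ^ r * r.factorial) + 3 / 2 * ℓ ^ r := by nlinarith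
    _ = Sr r * ℓ ^ r := by unfold Sr; ring

omit [NeZero n] in
/-- **THE RADII AT ALL LEVELS `≤ 𝖭+1`**: `rad_{i,k} ≤ G(r) · r_k` (the last step `𝖭 → 𝖭+1` does not rescale and has
`r_{𝖭+1} = r_𝖭`). [cite: Dimock2013BalabanIII, §3.5 proof of Lemma 14 (arXiv:1304.0705v1 TeX L2239–2249)] -/
theorem rad_le_Gr (hp : Large L lam) (r : ℕ) {i k : ℕ} (hik : i ≤ k) (hkN : k ≤ N + 1) :
    (rad L N (lay L lam N r) i k : ℝ) ≤ Gr r * ellN L lam N k ^ r := by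
  have hℓ1 : 1 ≤ ellN L lam N k ^ r := hp.one_le_ellN_pow N k r
  rcases Nat.lt_or_ge k (N + 1) with hlt | hge
  · have hkN' : k ≤ N := Nat.lt_succ_iff.1 hlt
    calc (rad L N (lay L lam N r) i k : ℝ) ≤ Sr r * ellN L lam N k ^ r := rad_le_Sr hp r hik hkN'
      _ ≤ Gr r * ellN L lam N k ^ r := mul_le_mul_of_nonneg_right (Sr_le_Gr r) (by linarith)
  · have hk : k = N + 1 := le_antisymm hkN hge
    subst hk
    have hlast : ellN L lam N (N + 1) = ellN L lam N N := ellN_last lam N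
    rcases Nat.lt_or_ge i (N + 1) with hi | hi
    · have hiN : i ≤ N := Nat.lt_succ_iff.1 hi
      rw [rad_succ_of_le _ hiN, Lstep_of_le le_rfl, Nat.div_one]
      push_cast
      have h1 := rad_le_Sr hp r hiN le_rfl
      have h2 := hp.lay_le N r (N + 1)
      have hℓ1' : 1 ≤ ellN L lam N N ^ r := hp.one_le_ellN_pow N N r
      rw [hlast] at h2 ⊢
      unfold Gr
      linarith
    · have hi' : i = N + 1 := le_antisymm hik hi
      subst hi'
      rw [rad_self]
      push_cast
      have h2 := hp.lay_le N r (N + 1)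
      have hG : (10 : ℝ) ≤ Gr r := by unfold Gr; linarith [one_le_Sr r]
      nlinarith

/-- **LEMMA 14 (ugh2) ON THE TORUS MODEL, IN CUBES** — [Dimock2013BalabanIII] TeX L2173–2177, verbatim: *"Vol(Λ_k^c) =
|(Λ_k^c)^{(k)}| ≤ 𝒪(1)(M r_k)³(|𝒞₀| + … + |𝒞_k|)"*: for the regions `Λ^c_k` of ANY history (the side conditions of
(understood) are not needed), with `[r_j] = ⌊(−log λ_j)^r⌋` layers, `log L ≥ 1` and `−log λ ≥ 1`: the number of
level-`k` cubes of `Λ^c_k` is at most `(2G(r)+1)^d · r_k^d · Σ_{i≤k} |𝒞_i|` (`d = 3` in print; `Vol = M³ × #cubes`,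
TeX L2167–2170). [cite: Dimock2013BalabanIII, §3.5 Lemma 14 eq. (ugh2) (arXiv:1304.0705v1 TeX L2173–2249)] -/
theorem card_lamC_le_ell (hp : Large L lam) (r : ℕ) (h : Hist d L n N) {k : ℕ} (hk : k ≤ N + 1) :
    ((lamC (lay L lam N r) h k).card : ℝ) ≤
      (2 * Gr r + 1) ^ d * (ellN L lam N k ^ r) ^ d * ∑ i ∈ range (k + 1), ((cubes h i).card : ℝ) := by
  set ℓ := ellN L lam N k with hℓ
  have hℓ1 : 1 ≤ ℓ ^ r := hp.one_le_ellN_pow N k r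
  have h0 := card_lamC_le (lay L lam N r) h k
  have h1 : ((lamC (lay L lam N r) h k).card : ℝ) ≤
      ∑ i ∈ range (k + 1), ((cubes h i).card : ℝ) * (2 * (rad L N (lay L lam N r) i k : ℝ) + 1) ^ d := by
    exact_mod_cast h0
  refine h1.trans ?_
  rw [mul_sum]
  refine sum_le_sum fun i hi => ?_
  have hik : i ≤ k := Nat.lt_succ_iff.1 (mem_range.1 hi)
  have hr := rad_le_Gr hp r hik hk
  have h2 : 2 * (rad L N (lay L lam N r) i k : ℝ) + 1 ≤ (2 * Gr r + 1) * ℓ ^ r := by nlinarith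
  have h3 : (2 * (rad L N (lay L lam N r) i k : ℝ) + 1) ^ d ≤ ((2 * Gr r + 1) * ℓ ^ r) ^ d :=
    pow_le_pow_left₀ (by positivity) h2 d
  calc ((cubes h i).card : ℝ) * (2 * (rad L N (lay L lam N r) i k : ℝ) + 1) ^ d
      ≤ ((cubes h i).card : ℝ) * ((2 * Gr r + 1) * ℓ ^ r) ^ d :=
        mul_le_mul_of_nonneg_left h3 (Nat.cast_nonneg _)
    _ = (2 * Gr r + 1) ^ d * (ℓ ^ r) ^ d * ((cubes h i).card : ℝ) := by rw [mul_pow]; ring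

end RadiusBound

/-! ## Part 6. DISCHARGE of the shape `HistorySum.Ugh2Bound` at `d = 3` and the end chain without the (ugh2) leaf -/

section Discharge

variable {L n N : ℕ} [NeZero L] [NeZero n]

/-- THE VOLUMES OF (randall): `|(Λ_j^c)^{(j)}| = M³ × #(L^{−(𝖭−j)}M cubes of Λ_j^c)` — [Dimock2013BalabanIII] TeX L2166–2170:
*"The number of elements in this set is the same as the number of M cubes when P_j, Q_j, R_j are scaled by L^{k−j} up to
𝕋^{−j}_{𝖬+𝖭−j}. In this case |P_j^{(j)}| is the number of unit cubes so |𝒞_j| = M^{−3}(|P^{(j)}_j| + |Q^{(j)}_j| +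
|R^{(j)}_j|)"* — for the regions `lamC` of a history with `[r_j] = ⌊(−log λ_j)^r⌋` layers: the volume function `v` of
`HistorySum.RandallBound` / `Ugh2Bound`, no longer abstract. [cite: Dimock2013BalabanIII, §3.5 eq. (ugh1) (arXiv:1304.0705v1 TeX L2164–2170)] -/
def vol (lam : ℝ) (r : ℕ) (M : ℝ) (h : Hist 3 L n N) (j : Fin (N + 2)) : ℝ :=
  M ^ 3 * ((lamC (lay L lam N r) h j.val).card : ℝ)

variable {lam : ℝ} in
/-- **LEMMA 14 (ugh2) AS PRINTED**, on the model — [Dimock2013BalabanIII] TeX L2173–2177, verbatim: *"Vol(Λ_k^c) =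
|(Λ_k^c)^{(k)}| ≤ 𝒪(1)(M r_k)³(|𝒞₀| + … + |𝒞_k|)"*, with `Vol = M³ × #cubes`, `𝒪(1) = A14 r`, `r_k = (−log λ_k)^r`, for
every history, every `k ≤ 𝖭+1`, `M ≥ 0`, under `log L ≥ 1`, `−log λ ≥ 1`. [cite: Dimock2013BalabanIII, §3.5 Lemma 14 eq. (ugh2) (arXiv:1304.0705v1 TeX L2173–2177)] -/
theorem lemma14 (hp : Large L lam) (r : ℕ) {M : ℝ} (hM : 0 ≤ M) (h : Hist 3 L n N) {k : ℕ} (hk : k ≤ N + 1) :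
    M ^ 3 * ((lamC (lay L lam N r) h k).card : ℝ)
      ≤ A14 r * (M * ellN L lam N k ^ r) ^ 3 * ∑ i ∈ range (k + 1), ((cubes h i).card : ℝ) := by
  have h1 := card_lamC_le_ell (d := 3) hp r h hk
  calc M ^ 3 * ((lamC (lay L lam N r) h k).card : ℝ)
      ≤ M ^ 3 * ((2 * Gr r + 1) ^ 3 * (ellN L lam N k ^ r) ^ 3 * ∑ i ∈ range (k + 1), ((cubes h i).card : ℝ)) :=
        mul_le_mul_of_nonneg_left h1 (pow_nonneg hM 3)
    _ = A14 r * (M * ellN L lam N k ^ r) ^ 3 * ∑ i ∈ range (k + 1), ((cubes h i).card : ℝ) := by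
        unfold A14; ring

/-- Reindexing `Σ_{i≤j} |𝒞_i|` from `ℕ`-levels to `Fin (𝖭+2)`-levels. [folklore] -/
theorem sum_range_card_cubes_eq (h : Hist 3 L n N) (j : Fin (N + 2)) :
    ∑ i ∈ range (j.val + 1), ((cubes h i).card : ℝ) =
      ∑ i ∈ univ.filter (fun i : Fin (N + 2) => i ≤ j), (ucnt h i : ℝ) := by
  have hj := j.isLt
  symm
  calc ∑ i ∈ univ.filter (fun i : Fin (N + 2) => i ≤ j), (ucnt h i : ℝ)
      = ∑ i ∈ univ.filter (fun i : Fin (N + 2) => i ≤ j), ((cubes h i.val).card : ℝ) :=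
        sum_congr rfl fun i _ => by rw [card_cubes_of_lt h i.isLt]
    _ = ∑ i : Fin (N + 2), (if i.val ≤ j.val then ((cubes h i.val).card : ℝ) else 0) := by
        rw [sum_filter]
        refine sum_congr rfl fun i _ => ?_
        simp only [Fin.le_def]
    _ = ∑ i ∈ range (N + 2), (if i ≤ j.val then ((cubes h i).card : ℝ) else 0) :=
        Fin.sum_univ_eq_sum_range (fun i => if i ≤ j.val then ((cubes h i).card : ℝ) else 0) (N + 2)
    _ = ∑ i ∈ (range (N + 2)).filter (fun i => i ≤ j.val), ((cubes h i).card : ℝ) := by rw [sum_filter]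
    _ = ∑ i ∈ range (j.val + 1), ((cubes h i).card : ℝ) := by
        congr 1
        ext i
        simp only [mem_filter, mem_range]
        omega

/-- Reindexing `Σ_{i≤𝖭+1} |𝒞_i|`. [folklore] -/
theorem sum_range_card_cubes_eq_univ (h : Hist 3 L n N) :
    ∑ i ∈ range (N + 2), ((cubes h i).card : ℝ) = ∑ i : Fin (N + 2), (ucnt h i : ℝ) := by
  rw [← Fin.sum_univ_eq_sum_range (fun i => ((cubes h i).card : ℝ)) (N + 2)]
  exact sum_congr rfl fun i _ => by rw [card_cubes_of_lt h i.isLt]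

/-- `|Θ|_M ≤ #(fine cubes over Θ)` at any depth (the block map is onto). [folklore] -/
theorem card_le_card_fine {d : ℕ} (m : ℕ) (Θ : Finset (TPt d n)) : Θ.card ≤ (fine L n m Θ).card := by
  classical
  have hsub : Θ ⊆ (fine L n m Θ).image (tcoarse (L ^ m) n) := by
    intro b hb
    obtain ⟨a, ha⟩ := czmap_surjective (Ls := L ^ m) (Nc := n) (Nf := L ^ m * n) rfl b
    refine mem_image.2 ⟨a, ?_, ha⟩
    unfold fine
    rw [mem_filter, ← czmap_eq_tcoarse, ha]
    exact ⟨mem_univ _, hb⟩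
  exact (card_le_card hsub).trans card_image_le

variable {lam : ℝ}

/-- **LEMMA 14 (ugh2) DISCHARGES THE SHAPE `HistorySum.Ugh2Bound`** for the actual volumes `vol` of the regions of ANY
finite set `H` of histories whose top region `Λ^c_{𝖭+1}` has at least `|Θ|_M` cubes (in print `Λ^c_{𝖭+1} = Θ`,
TeX L2151), with the explicit `𝒪(1) = A14 r`, under `log L ≥ 1`, `−log λ ≥ 1`, `M ≥ 0`.  Both printed uses are served:
(1) per level (TeX L2262–2271) and (2) at the top (TeX L2287–2294 *"The second exponential is bounded using (ugh2)
again … = exp(−c₂′(−log λ)^{2p₀−3r}|Θ|_M)"*). [cite: Dimock2013BalabanIII, §3.5 Lemma 14 eq. (ugh2) (arXiv:1304.0705v1 TeX L2173–2177)] -/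
theorem ugh2Bound_regions (hp : Large L lam) (r : ℕ) {M : ℝ} (hM : 0 ≤ M) (Θ : Finset (TPt 3 n))
    (H : Finset (Hist 3 L n N))
    (hH : ∀ h ∈ H, (Θ.card : ℝ) ≤ (lamC (lay L lam N r) h (N + 1)).card) :
    Ugh2Bound Θ H (vol lam r M) (A14 r) M lam r := by
  constructor
  · intro h _ j
    have hk : j.val ≤ N + 1 := Nat.lt_succ_iff.1 j.isLt
    have h1 := card_lamC_le_ell (d := 3) hp r h hk
    rw [sum_range_card_cubes_eq h j, ellN_fin] at h1
    have hM3 : 0 ≤ M ^ 3 := pow_nonneg hM 3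
    unfold vol
    calc M ^ 3 * ((lamC (lay L lam N r) h j.val).card : ℝ)
        ≤ M ^ 3 * ((2 * Gr r + 1) ^ 3 * (ell L lam N j ^ r) ^ 3 *
            ∑ i ∈ univ.filter (fun i : Fin (N + 2) => i ≤ j), (ucnt h i : ℝ)) :=
          mul_le_mul_of_nonneg_left h1 hM3
      _ = A14 r * (M * ell L lam N j ^ r) ^ 3 *
            ∑ i ∈ univ.filter (fun i : Fin (N + 2) => i ≤ j), (ucnt h i : ℝ) := by
          unfold A14; ring
  · intro h hh
    have h1 := card_lamC_le_ell (d := 3) hp r h (le_refl (N + 1))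
    rw [sum_range_card_cubes_eq_univ h, show ellN L lam N (N + 1) = ell L lam N (Fin.last (N + 1)) from rfl] at h1
    calc (Θ.card : ℝ) ≤ ((lamC (lay L lam N r) h (N + 1)).card : ℝ) := hH h hh
      _ ≤ (2 * Gr r + 1) ^ 3 * (ell L lam N (Fin.last (N + 1)) ^ r) ^ 3 * ∑ i, (ucnt h i : ℝ) := h1
      _ = A14 r * (ell L lam N (Fin.last (N + 1)) ^ r) ^ 3 * ∑ i, (ucnt h i : ℝ) := by unfold A14; ring

/-- THE HISTORIES OVER `Θ` WHOSE TOP REGION IS `Θ`: the free histories of `HistorySum.freeHist` (every region a set of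
fine cubes inside `Θ`, TeX L2310) with `Λ^c_{𝖭+1} = Θ` (TeX L2151 *"Σ_{{P_j,Q_j,R_j}: Λ^c_{𝖭+1} = Θ}"*; `Θ` seen at
depth `𝖭 − (𝖭+1) = 0` through `HistorySum.fine`).  This is the natural index set of (randall) on the model: the
print's further side conditions of (understood) (`P_{j+1} ⊂ Λ̄_j, Q_{j+1} ⊂ Ω^♮_{j+1}, R_{j+1} ⊂ Ω_{j+1}`) only shrink
it, and (randall)'s summands are positive.  When `Θ` is the top region `Λ^c_{𝖭+1}(h)` of NO free history `h` over `Θ`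
this set is EMPTY, and a hypothesis `RandallBound KΘ (regionHist … Θ) …` then reads `KΘ ≤ 0` (empty sum).  This matches
print: `𝒦′(Θ)` is DEFINED as the sum *"𝒦′(Θ) = Σ_{𝚷⁺: Λ^c_{𝖭+1} = Θ} ∫ …"* (TeX L1589–1598, right after (under)
L1584–1588) over the histories with top region `Θ` — under the nesting of Parts 7–8 a subset of `regionHist … Θ` —, hence
`𝒦′(Θ) = 0` for such `Θ` (cross-read C-pv01-73, advisory A2).
[cite: Dimock2013BalabanIII, §3.4 eq. (randall) (arXiv:1304.0705v1 TeX L2149–2155)] -/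
def regionHist (L N : ℕ) [NeZero L] (lam : ℝ) (r : ℕ) (Θ : Finset (TPt 3 n)) : Finset (Hist 3 L n N) :=
  (freeHist L n N Θ).filter fun h => lamC (lay L lam N r) h (N + 1) = fine L n (N - (N + 1)) Θ

/-- `regionHist Θ ⊆ freeHist Θ`. [folklore] -/
theorem regionHist_subset (r : ℕ) (Θ : Finset (TPt 3 n)) : regionHist L N lam r Θ ⊆ freeHist L n N Θ :=
  filter_subset _ _

/-- The top region of a history of `regionHist Θ` has at least `|Θ|_M` cubes. [folklore] -/
theorem card_le_of_mem_regionHist {r : ℕ} {Θ : Finset (TPt 3 n)} {h : Hist 3 L n N}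
    (hh : h ∈ regionHist L N lam r Θ) : (Θ.card : ℝ) ≤ (lamC (lay L lam N r) h (N + 1)).card := by
  have := (mem_filter.1 hh).2
  rw [this]
  exact_mod_cast card_le_card_fine (L := L) (N - (N + 1)) Θ

/-- (ugh2) for the natural index set. [cite: Dimock2013BalabanIII, §3.5 Lemma 14 eq. (ugh2) (arXiv:1304.0705v1 TeX L2173–2177)] -/
theorem ugh2Bound_regionHist (hp : Large L lam) (r : ℕ) {M : ℝ} (hM : 0 ≤ M) (Θ : Finset (TPt 3 n)) :
    Ugh2Bound Θ (regionHist L N lam r Θ) (vol lam r M) (A14 r) M lam r :=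
  ugh2Bound_regions hp r hM Θ _ fun _ hh => card_le_of_mem_regionHist hh

omit [NeZero L] [NeZero n] in
/-- `HistorySum.LargeLog` implies this module's `Large`. [folklore] -/
theorem large_of_largeLog {C c₂ p₀ A M κ : ℝ} {r n₀ : ℕ} (hp : LargeLog C c₂ p₀ A M κ lam r n₀ L) :
    Large L lam :=
  ⟨hp.logL, by linarith [hp.ell₀]⟩

end Discharge

section EndChain

open Literature.MathematicalPhysics.QuantumFieldTheory.Balaban1983to89.B12TreeDecay (kappa₀ K₀)
open Literature.MathematicalPhysics.QuantumFieldTheory.Dimock2011to13.HoleSummability (kappa₁ K₁)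

/-- **(stingray) ∧ (under) ∧ (randall) ⇒ COROLLARY 1, WITH NO GEOMETRIC LEAF** — `HistorySum.stability_of_randall` with
its hypothesis (ugh2) DISCHARGED by this module's Lemma 14: (randall) is asked for the ACTUAL volumes `vol` of the
regions `Λ^c_j` generated by (understood) from the histories over `Θ` with top region `Θ` (`regionHist`), its `C` is
`Cr`, and the `𝒪(1)` of Lemma 14 inside `LargeLog` is the explicit `A14 r` (for a `Θ` that is the top region of no
free history over `Θ`, `regionHist … Θ = ∅` and `hR Θ` reads `K' Θ ≤ 0` — as in print, where `𝒦′(Θ) = 0` for such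
`Θ` by its definition TeX L1589–1598; see `regionHist`).  After this, on the template side,
EVERYTHING of [Dimock2013BalabanIII] §3 after *"At this point all the fields are gone"* (TeX L2155) is kernel-checked
over the cell's torus model from the analytic outputs (stingray), (under), (randall) alone. [cite: Dimock2013BalabanIII, §3 (arXiv:1304.0705v1 TeX L1418–2505)] -/
theorem stability_of_regions {L m Mv N : ℕ} [NeZero L] [NeZero (L ^ (Mv - m))] {lam ε₀ μ₀ : ℝ}
    {K : TDom 3 (L ^ (Mv - m)) → ℝ} {K' : Finset (TPt 3 (L ^ (Mv - m))) → ℝ}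
    {C Cr c₂ p₀ M κ β κ' κ₀ r₁ : ℝ} {r n₀ : ℕ} (hm : m ≤ Mv)
    (hrep : ComponentRepresentation L Mv N (L ^ (Mv - m)) lam ε₀ μ₀ K)
    (hund : UnderBound (L ^ (Mv - m)) K K' C lam β κ')
    (hp : LargeLog Cr c₂ p₀ (A14 r) M κ lam r n₀ L)
    (hR : ∀ Θ : Finset (TPt 3 (L ^ (Mv - m))),
      RandallBound (K' Θ) (regionHist L N lam r Θ) (vol lam r M) Cr c₂ p₀ lam)
    (hκ₁ : κ' ≤ κ - 1) (hκ₀ : kappa₀ 32 6 ≤ κ₀) (hκ₁' : kappa₁ 3 ≤ κ₀) (hκ : κ₀ ≤ κ') (hC : 0 ≤ C)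
    (hβn₀ : β ≤ n₀) (hsmall : lam ^ (β / 2) * Real.exp (2 * (κ' - κ₀)) ≤ 1)
    (htoot : 32 * (K₀ 32 6 + C * K₀ 32 6 + C * K₁ 3) * lam ^ (β / 2) ≤ 1)
    (hr₁ : kappa₀ 32 6 ≤ r₁) (hrate : r₁ + 2 * kappa₀ 32 6 + 2 ≤ κ' - κ₀ - 1)
    (hKP : Real.exp (1 / 4) * lam ^ (β / 2) * Real.exp (5 * r₁ + 1) * K₀ 32 6 * 32 ≤ 1)
    (hM : Real.exp 1 * 32 * K₀ 32 6 ^ 2 * Real.exp (1 / 4) * K₀ 32 6 ≤ ((L : ℝ) ^ m) ^ 3) :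
    Real.exp (-(lam ^ (β / 2) * (L : ℝ) ^ (3 * Mv))) ≤ relativePartitionFunction L Mv N 1 lam ε₀ μ₀ ∧
      relativePartitionFunction L Mv N 1 lam ε₀ μ₀ ≤ Real.exp (lam ^ (β / 2) * (L : ℝ) ^ (3 * Mv)) :=
  stability_of_randall hm hrep hund hp
    (fun Θ => ⟨regionHist L N lam r Θ, vol lam r M, regionHist_subset r Θ, hR Θ,
      ugh2Bound_regionHist (large_of_largeLog hp) r hp.M_nonneg Θ⟩)
    hκ₁ hκ₀ hκ₁' hκ hC hβn₀ hsmall htoot hr₁ hrate hKP hM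

end EndChain

/-! ## Part 8. (v1.1) The print's index set of (randall) lies in `regionHist Θ` under (N1)–(N2): the block maps of
the tower commute with `HistorySum.fine`'s one-shot block map, so nested regions all lie over `Θ` -/

section IndexSet

variable {d L n N : ℕ} [NeZero L] [NeZero n]

/-- ONE STEP OF THE TOWER COMMUTES WITH THE ONE-SHOT BLOCK MAP: the `M`-cube over a cube of level `j` is the `M`-cube over
its block of level `j+1` — `tcoarse (L^{𝖭−(j+1)}) n ∘ cz_j = tcoarse (L^{𝖭−j}) n` (so the iterated block maps of Part 4 ARE
`HistorySum.fine`'s `tcoarse (L^m) n`, reading (vii) of the header discharged). [folklore] -/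
theorem tcoarse_cz (j : ℕ) (c : TPt d (L ^ (N - j) * n)) :
    tcoarse (L ^ (N - (j + 1))) n (cz L n N j c) = tcoarse (L ^ (N - j)) n c := by
  have e1 : cz L n N j c = proj (L ^ (N - (j + 1)) * n) (coarse (Lstep L N j) (natLift c)) := rfl
  have e2 : c = proj (L ^ (N - j) * n) (natLift c) := (proj_natLift c).symm
  -- `⌊⌊x/a⌋/b⌋ = ⌊x/(a·b)⌋` (nested partitions compose; cf. `B16SProfile.coarse_coarse` on the Bałaban side)
  have cc : ∀ (a b : ℕ) (x : Pt d), coarse b (coarse a x) = coarse (a * b) x := fun a b x => by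
    funext i
    simp only [coarse]
    push_cast
    exact Int.ediv_ediv_of_nonneg (by positivity)
  rw [e1, TreeLengthTorusTransfer.tcoarse_proj, cc]
  conv_rhs => rw [e2, TreeLengthTorusTransfer.tcoarse_proj]
  congr 2
  have := tower_mod L n N j
  -- `Lstep_j · L^{𝖭−(j+1)} = L^{𝖭−j}` (cancel the common factor `n ≠ 0`)
  have hn : 0 < n := Nat.pos_of_ne_zero (NeZero.ne n)
  have h2 : Lstep L N j * L ^ (N - (j + 1)) * n = L ^ (N - j) * n := by rw [this]; ring
  exact Nat.eq_of_mul_eq_mul_right hn h2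

/-- Membership over `Θ` is invariant along the tower: `c` lies over `Θ` iff its block does. [folklore] -/
theorem mem_fine_iff_cz_mem_fine (j : ℕ) (Θ : Finset (TPt d n)) (c : TPt d (L ^ (N - j) * n)) :
    c ∈ fine L n (N - j) Θ ↔ cz L n N j c ∈ fine L n (N - (j + 1)) Θ := by
  unfold fine
  rw [mem_filter, mem_filter, tcoarse_cz]
  simp

/-- THE ITERATED BLOCK MAP from level `i` to level `i + k` (composition of the `cz` of the steps, cast-free along the
tower). [folklore] -/
def iter (L n N i : ℕ) [NeZero L] [NeZero n] : (k : ℕ) → TPt d (L ^ (N - i) * n) → TPt d (L ^ (N - (i + k)) * n)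
  | 0 => fun c => c
  | k + 1 => fun c => cz L n N (i + k) (iter L n N i k c)

/-- Along the iterated block map membership over `Θ` is invariant. [folklore] -/
theorem mem_fine_iff_iter (i : ℕ) (Θ : Finset (TPt d n)) (c : TPt d (L ^ (N - i) * n)) :
    ∀ k, c ∈ fine L n (N - i) Θ ↔ iter L n N i k c ∈ fine L n (N - (i + k)) Θ
  | 0 => Iff.rfl
  | k + 1 => (mem_fine_iff_iter i Θ c k).trans (mem_fine_iff_cz_mem_fine (i + k) Θ _)

/-- Under the nesting conditions the iterated block map keeps `Λ^c_i` inside `Λ^c_{i+k}`. [folklore] -/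
theorem iter_mem_lamC (t : ℕ → ℕ) (h : Hist d L n N) (i : ℕ)
    (hc : ∀ j, j < N → L - 1 ≤ 5 * t j ∧ 5 * t j / L + 1 ≤ 5 * t (j + 1))
    {c : TPt d (L ^ (N - i) * n)} (hci : c ∈ lamC t h i) : ∀ k, iter L n N i k c ∈ lamC t h (i + k)
  | 0 => hci
  | k + 1 => by
    classical
    exact image_lamC_subset_succ t h (i + k) (hc (i + k)) (mem_image_of_mem _ (iter_mem_lamC t h i hc hci k))

/-- **THE PRINT'S INDEX SET IS INSIDE `regionHist Θ`.**  If the regions of a history are NESTED (conditions (N1)–(N2)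
of `image_lamC_subset_succ` at the rescaling steps) and its top region lies over `Θ` (`Λ^c_{𝖭+1} ⊆` the `M`-cubes of
`Θ`; in print `Λ^c_{𝖭+1} = Θ`, TeX L2151), then EVERY region `P_i, Q_i, R_i` is a set of fine cubes over `Θ` — the
content of [Dimock2013BalabanIII] TeX L2310 *"unions of L^{−(𝖭−j)}M cubes □ contained in Θ"* — i.e. the history is
free over `Θ` (`HistorySum.freeHist`).  With `Λ^c_{𝖭+1} = fine (𝖭−(𝖭+1)) Θ` it is then a member of `regionHist Θ`
(`mem_regionHist_of_nested`). [cite: Dimock2013BalabanIII, §3.5 proof of Lemma 15 (arXiv:1304.0705v1 TeX L2310)] -/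
theorem mem_freeHist_of_nested (t : ℕ → ℕ) (h : Hist d L n N) (Θ : Finset (TPt d n))
    (hc : ∀ j, j < N → L - 1 ≤ 5 * t j ∧ 5 * t j / L + 1 ≤ 5 * t (j + 1))
    (htop : lamC t h (N + 1) ⊆ fine L n (N - (N + 1)) Θ) : h ∈ freeHist L n N Θ := by
  rw [mem_freeHist]
  intro j X c hcX
  -- `c ∈ Λ^c_j`, push it to level `𝖭+1 = j + (𝖭+1−j)` and read membership over `Θ` there
  have hj : j.val < N + 2 := j.isLt
  have hcj : c ∈ lamC t h j.val := by
    have := slot_subset_lamC t h j.val X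
    rw [slot_of_lt h hj] at this
    exact this hcX
  have key : ∀ m, (∀ x ∈ lamC t h m, x ∈ fine L n (N - m) Θ) → ∀ i k, i + k = m →
      ∀ y ∈ lamC t h i, y ∈ fine L n (N - i) Θ := by
    intro m hm i k hik y hy
    subst hik
    exact (mem_fine_iff_iter i Θ y k).2 (hm _ (iter_mem_lamC t h i hc hy k))
  exact key (N + 1) (fun x hx => htop hx) j.val (N + 1 - j.val) (by omega) c hcj

/-- The print's histories (nested, `Λ^c_{𝖭+1} = Θ` as the set of `M`-cubes over `Θ`) belong to `regionHist Θ`, at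
`d = 3` with `[r_j] = ⌊(−log λ_j)^r⌋`. [cite: Dimock2013BalabanIII, §3.4 eq. (randall) (arXiv:1304.0705v1 TeX L2149–2155)] -/
theorem mem_regionHist_of_nested {lam : ℝ} (r : ℕ) (h : Hist 3 L n N) (Θ : Finset (TPt 3 n))
    (hc : ∀ j, j < N → L - 1 ≤ 5 * lay L lam N r j ∧ 5 * lay L lam N r j / L + 1 ≤ 5 * lay L lam N r (j + 1))
    (htop : lamC (lay L lam N r) h (N + 1) = fine L n (N - (N + 1)) Θ) : h ∈ regionHist L N lam r Θ := by
  unfold regionHist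
  rw [mem_filter]
  exact ⟨mem_freeHist_of_nested _ h Θ hc htop.le, htop⟩

/-- **(N1)–(N2) FROM SMALLNESS OF `λ` AT FIXED `L, r`**: if `log L ≥ 1`, `(−log λ)^r ≥ L` (so `[r_j] ≥ L − 1`) and the
consecutive ratio `r_j/r_{j+1} = (1 + log L/(−log λ_{j+1}))^r` is at most `2` — guaranteed by `(1 + log L/(−log λ))^r ≤ 2`
— then (N1) `L − 1 ≤ 5[r_j]` and (N2) `⌊5[r_j]/L⌋ + 1 ≤ 5[r_{j+1}]` hold at every rescaling step `j < 𝖭`. [folklore] -/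
theorem nesting_of_small {lam : ℝ} (hp : Large L lam) (r : ℕ) (hL : (L : ℝ) ≤ (-Real.log lam) ^ r)
    (hratio : (1 + Real.log L / (-Real.log lam)) ^ r ≤ 2) (j : ℕ) (hj : j < N) :
    L - 1 ≤ 5 * lay L lam N r j ∧ 5 * lay L lam N r j / L + 1 ≤ 5 * lay L lam N r (j + 1) := by
  have h3 : 3 ≤ L := hp.three_le_L
  have hL3 : (3 : ℝ) ≤ L := by exact_mod_cast h3
  have hℓ0 : 1 ≤ -Real.log lam := hp.ell₀
  have hlogL : 1 ≤ Real.log L := hp.logL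
  -- the levels: ℓ_{j+1} ≥ −log λ, ℓ_j = ℓ_{j+1} + log L
  set a := ellN L lam N (j + 1) with ha
  set b := ellN L lam N j with hb
  have ha1 : -Real.log lam ≤ a := by
    rw [ha]; unfold ellN
    have : (0 : ℝ) ≤ ((N - (j + 1) : ℕ) : ℝ) * Real.log L := mul_nonneg (Nat.cast_nonneg _) (by linarith)
    linarith
  have hapos : 0 < a := by linarith
  have hba : b = a + Real.log L := by
    rw [hb, ha]; unfold ellN
    have : (N - j : ℕ) = (N - (j + 1)) + 1 := by omega
    rw [this, Nat.cast_add, Nat.cast_one]; ring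
  -- r-th powers: a^r ≥ (−log λ)^r ≥ L and b^r ≤ 2 a^r
  have har : (L : ℝ) ≤ a ^ r := hL.trans (pow_le_pow_left₀ (by linarith) ha1 r)
  have hbr : b ^ r ≤ 2 * a ^ r := by
    have e : b = a * (1 + Real.log L / a) := by rw [hba]; field_simp
    rw [e, mul_pow]
    have h1 : (1 + Real.log L / a) ^ r ≤ (1 + Real.log L / (-Real.log lam)) ^ r := by
      refine pow_le_pow_left₀ (by positivity) ?_ r
      have : Real.log L / a ≤ Real.log L / (-Real.log lam) :=
        div_le_div_of_nonneg_left (by linarith) (by linarith) ha1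
      linarith
    nlinarith [pow_nonneg hapos.le r]
  -- integer parts: t_j ≤ b^r, t_{j+1} > a^r − 1
  have htj : (lay L lam N r j : ℝ) ≤ b ^ r := hp.lay_le N r j
  have htj' : b ^ r < (lay L lam N r j : ℝ) + 1 := by
    have := Nat.lt_floor_add_one (b ^ r)
    rw [hb] at this ⊢; exact_mod_cast this
  have htj1 : a ^ r < (lay L lam N r (j + 1) : ℝ) + 1 := by
    have := Nat.lt_floor_add_one (a ^ r)
    rw [ha] at this ⊢; exact_mod_cast this
  have hab : a ≤ b := by rw [hba]; linarith
  have hbr' : (L : ℝ) ≤ b ^ r := har.trans (pow_le_pow_left₀ hapos.le hab r)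
  constructor
  · -- (N1): L − 1 ≤ 5 t_j, from L ≤ b^r < t_j + 1
    have : (L : ℝ) < (lay L lam N r j : ℝ) + 1 := by linarith
    have h' : L < lay L lam N r j + 1 := by exact_mod_cast this
    omega
  · -- (N2): ⌊5 t_j / L⌋ + 1 ≤ 5 t_{j+1}, from ⌊5t_j/L⌋ ≤ 5 b^r/L ≤ 10 a^r/3 ≤ 5 a^r − 5 < 5 t_{j+1} (a^r ≥ 3)
    have hdiv : ((5 * lay L lam N r j / L : ℕ) : ℝ) ≤ ((5 * lay L lam N r j : ℕ) : ℝ) / (L : ℝ) :=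
      Nat.cast_div_le
    push_cast at hdiv
    have hLpos : (0 : ℝ) < L := by linarith
    have h1 : (5 * (lay L lam N r j : ℝ)) / L ≤ 10 * a ^ r / L :=
      div_le_div_of_nonneg_right (by linarith) hLpos.le
    have h2 : 10 * a ^ r / L ≤ 10 * a ^ r / 3 := div_le_div_of_nonneg_left (by positivity) (by norm_num) hL3
    have har3 : (3 : ℝ) ≤ a ^ r := hL3.trans har
    have : ((5 * lay L lam N r j / L : ℕ) : ℝ) < 5 * (lay L lam N r (j + 1) : ℝ) := by nlinarith
    have h' : 5 * lay L lam N r j / L < 5 * lay L lam N r (j + 1) := by exact_mod_cast this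
    omega

end IndexSet

end Literature.MathematicalPhysics.QuantumFieldTheory.Dimock2011to13.RegionVolume

end
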